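import Literature.MathematicalPhysics.QuantumFieldTheory.Balaban1983to89.B1Props21to23RegularTorus
import Literature.MathematicalPhysics.QuantumFieldTheory.Balaban1983to89.B1Ineq225RegularTorus
import Literature.MathematicalPhysics.QuantumFieldTheory.Balaban1983to89.B1Eq243HiggsModel
import Literature.MathematicalPhysics.QuantumFieldTheory.Balaban1983to89.B3Sect2StatementsPart2
import Literature.MathematicalPhysics.QuantumFieldTheory.Balaban1983to89.B2Ineq329ZeroAveraging
import Literature.MathematicalPhysics.QuantumFieldTheory.Balaban1983to89.B2Eq246ScalarStep

/-!
# Bałaban, *(Higgs)₂,₃ quantum fields in a finite volume III. Renormalization* [B3] — (2.10) p. 426 AT A REGULAR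
NON-CONSTANT BACKGROUND `B̃ = A` ON THE TORUS `Ω = T_η`, PROVED for a concrete carrier of `B3Sect2StatementsPart2.ScaledKernels`

statement-level skeleton of published theorems with citation tags; proofs where landed; nothing here is a claim about the Yang–Mills mass gap

T. Bałaban, Commun. Math. Phys. **88** (1983) 411–445 [cite: Balaban1983Higgs3]; inputs from part I, Commun. Math. Phys. **85**
(1982) 603–636 [cite: Balaban1982Higgs1] as landed in the tree.

## What is printed (p. 426 [PDF 16], verbatim)

*"For the propagators G^η_{(j)} we apply the inequality |G^η_{(j)}(Ω, B̃; x, x′)| ≤ O(1)(L^jη)^{−d+2}e^{−δ₁(L^jη)^{−1}|x−x′|}, (2.10)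
and if the propagator is differentiated, then for each differentiation, there is an additional factor (L^jη)^{−1} on the right
side. … These inequalities will be used in the next chapter. They all are obtained by rescaling from the η-lattice to the
L^{−j}-lattice and application of Propositions I.2.1 and I.2.3."*  The pieces are those of the decomposition (2.6) p. 424,
`G^η_k = Σ_{j=0}^{k−1} G^η_{(j)}`, i.e. the terms of (I.2.43): `G^η_{(0)} = C^{(0)} = G^ε_1`,
`G^η_{(j)} = a_j²(L^jε)^{−4}G^ε_jQ_j^*C^{(j)}Q_jG^ε_j` (`1 ≤ j ≤ k − 1`).

## What this file proves (`ineq210_regularTorus`), and how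

The decl of record `ScaledKernels.Ineq210 δ₁ C` (r15's `B3Sect2StatementsPart2`) for the concrete carrier `regTorusKernels S C A m² a k`
of the (Higgs)₂,₃ torus model at a `δ_A`-regular, non-constant `u(N)`-background `A` (`Ω = T_η`, the whole torus), with constants
uniform in the volume: §1 the pieces (2.6) as covariant operators (`pieceA`) and (2.6) itself (`sum_pieceA` ⇐ (I.2.43) covariant,
`B1Eq243HiggsModel.display243_univ`); §2 the lattice geometry `|x − x′| ≤ L^l|x_l − x′_l| + L^l − 1`; §3 the engine bounding the kernel
of one sandwich `G^ε_lQ_l^*C^{(l)}Q_lG^ε_l` from the (I.2.25) value/derivative clauses and the (I.2.34) kernel bound at level `l`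
(adjointness `(Q_lG^ε_l)^* = G^ε_lQ_l^*` for the products (I.1.5) gives the factor `L^{−ld}`; three-kernel convolution on `T^{(l)}` by the
uniform torus sums of [Balaban1983RegularityDecay, Sect. 5]); §4 the pieces in kernel form with the print's scaling
`ε^{−d}a_j²(L^jε)^{−4}(L^jε)^{6}L^{−jd} = a_j²(L^jε)^{2−d}`; §5 the carrier; §6 the theorem, fed by Proposition I.2.1 (2.25) at a regular `A`
on the torus (`B1Ineq225RegularTorus.norm_propagatorK_reg_decay`, `norm_covDeriv_propagatorK_reg_decay`) and Proposition I.2.3 (2.34)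
at a regular `A` on the torus (`B1Props21to23RegularTorus.ineq234_236_regular_torus_std`), plus a non-vacuity witness of the hypotheses.

## Dictionary and honest scope

`T_η := Site P 0` (`η = ε`, the finest lattice of the volume `P`; lengths in ε-units, `dist x x′ = ε|x − x′|` with the sup torus distance
(I.1.3)); `|G^η_{(j)}(x, x′)| := ε^{−d}Σ_{i′}‖(G^η_{(j)}e_{(x′,i′)})(x)‖` — the kernel w.r.t. the `ε^d`-weighted product (I.1.5), measured by
the column-sum norm over the source colour `i′` of its `N × N` block; the derivative is the covariant one (I.1.7) in the row variable.
NOT covered: regions `Ω ≠ T_η` and everything involving `∂Ω`/`Ω₂` ((2.5), (2.11), (2.12) are not modelled — those carrier fields are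
`0` and nothing is claimed about them); `m² = 0`; volumes outside the `Shape` sub-family (`L` odd `> 1`, equal periods) or not tiled by
`K₀`-cubes (`K₀ ∣ M`, `3K₀ ≤ 2M`, `K₀ ≥ K₀,min`) — the hypotheses of the cited torus theorems; the constants depend on `K₀` as there.
No `def … : Prop`, no new named fact; axioms standard.
-/

noncomputable section

open scoped BigOperators InnerProductSpace Matrix

namespace Literature.MathematicalPhysics.QuantumFieldTheory.Balaban1983to89.B3Ineq210RegularTorus

open HiggsLattice (ChargeData ScalarField siteInner covDeriv)
open HiggsCovariance (propagatorK avgQkLin avgQkAdj E)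
open HiggsCovariancePos (siteInner_avgQkLin)
open HiggsAveraging (blockIter)
open HiggsFluctMeasure (coeff221)
open B1Eq221Coordinates (fieldCoord)
open B1Eq230FluctCov (mat Ix cb fluctCovA wt adjoint_transfer dotProduct_wt_mulVec cb_repr mat_comp mat_smul)
open B1Eq230FluctCovPos (siteInner_propagatorK_comm)
open B1Ineq234Concrete (val_blockIter_all tdist_blockIter_le_real fieldCoord_symm_single rho rho_sumBound rho_eq_tdist
  profile profile_nonneg' nCol nCol_eq mat_apply_eq_dotProduct)
open B1Ineq227BackgroundTorus (abs_fieldCoord_le norm_fieldCoord_symm_le)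
open B1Ineq234LevelZero (tdist_comm tdist_triangle_real)
open B3Sect2StatementsPart2 (ScaledKernels)

variable {P : HiggsLattice.Params} {N : ℕ}

/-! ## §0 Coordinate and lattice bookkeeping -/

section Algebra

/-- `|(mat f)(p, q)| ≤ ‖(f e_q)(x_p)‖` (one orthonormal coordinate is at most the norm). [cite: Balaban1982Higgs1, (1.5) p.604] -/
theorem abs_mat_le_norm {i j : ℕ} (f : ScalarField P i N →ₗ[ℝ] ScalarField P j N) (p : HiggsLattice.Site P j × Ix N)
    (q : HiggsLattice.Site P i × Ix N) : |mat f p q| ≤ ‖f (cb P N i q) p.1‖ := by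
  rw [B2Eq246ScalarStep.mat_apply]
  exact abs_fieldCoord_le _ p.1 p.2

/-- The basis field `e_q` has site norms `≤ √N`. [cite: Balaban1982Higgs1, (1.5) p.604] -/
theorem norm_cb_le {j : ℕ} (q : HiggsLattice.Site P j × Ix N) (y : HiggsLattice.Site P j) :
    ‖cb P N j q y‖ ≤ Real.sqrt N := by
  rw [← fieldCoord_symm_single]
  refine norm_fieldCoord_symm_le _ y fun i => ?_
  rw [Pi.single_apply]
  split_ifs <;> simp

/-- `e_q` vanishes off the site of `q`. [cite: Balaban1982Higgs1, (1.5) p.604] -/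
theorem cb_apply_of_ne' {j : ℕ} (q : HiggsLattice.Site P j × Ix N) {y : HiggsLattice.Site P j} (h : y ≠ q.1) :
    cb P N j q y = 0 :=
  B1Ineq234Concrete.cb_apply_of_ne h

/-- Expansion of a linear map applied to a field in the coordinate basis, evaluated at a site:
`(f φ)(x) = Σ_s φ_s · (f e_s)(x)`. [cite: Balaban1982Higgs1, (1.5) p.604] -/
theorem apply_eq_sum_coord {i j : ℕ} (f : ScalarField P i N →ₗ[ℝ] ScalarField P j N) (φ : ScalarField P i N)
    (x : HiggsLattice.Site P j) :
    f φ x = ∑ s : HiggsLattice.Site P i × Ix N, fieldCoord (E N) (HiggsLattice.Site P i) φ s • f (cb P N i s) x := by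
  conv_lhs => rw [← (cb P N i).sum_repr φ]
  rw [map_sum, Finset.sum_apply]
  refine Finset.sum_congr rfl fun s _ => ?_
  rw [map_smul, Pi.smul_apply, cb_repr]

/-- The norm of `(f φ)(x)` through the coordinates of `φ`. [cite: Balaban1982Higgs1, (1.5) p.604] -/
theorem norm_apply_le_sum_coord {i j : ℕ} (f : ScalarField P i N →ₗ[ℝ] ScalarField P j N) (φ : ScalarField P i N)
    (x : HiggsLattice.Site P j) :
    ‖f φ x‖ ≤ ∑ s : HiggsLattice.Site P i × Ix N,
      |fieldCoord (E N) (HiggsLattice.Site P i) φ s| * ‖f (cb P N i s) x‖ := by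
  rw [apply_eq_sum_coord]
  refine (norm_sum_le _ _).trans (Finset.sum_le_sum fun s _ => ?_)
  rw [norm_smul, Real.norm_eq_abs]

/-- `D^ε_A` is additive in the field. [cite: Balaban1982Higgs1, (1.7) p.605] -/
theorem covDeriv_add'' (C : ChargeData N) (A : HiggsLattice.VecField P 0) (u v : ScalarField P 0 N) (b : HiggsLattice.PBond P 0) :
    covDeriv C A (u + v) b = covDeriv C A u b + covDeriv C A v b := by
  unfold covDeriv
  rw [Pi.add_apply, Pi.add_apply, map_add, ← smul_add]
  congr 1
  abel

/-- `D^ε_A` is homogeneous in the field. [cite: Balaban1982Higgs1, (1.7) p.605] -/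
theorem covDeriv_smul'' (C : ChargeData N) (A : HiggsLattice.VecField P 0) (c : ℝ) (u : ScalarField P 0 N)
    (b : HiggsLattice.PBond P 0) : covDeriv C A (c • u) b = c • covDeriv C A u b := by
  unfold covDeriv
  rw [Pi.smul_apply, Pi.smul_apply, map_smul, smul_comm c, ← smul_sub]

/-- `D^ε_A 0 = 0`. [cite: Balaban1982Higgs1, (1.7) p.605] -/
theorem covDeriv_zero'' (C : ChargeData N) (A : HiggsLattice.VecField P 0) (b : HiggsLattice.PBond P 0) :
    covDeriv C A (0 : ScalarField P 0 N) b = 0 := by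
  unfold covDeriv; simp

/-- `D^ε_A` of a finite sum. [cite: Balaban1982Higgs1, (1.7) p.605] -/
theorem covDeriv_sum'' (C : ChargeData N) (A : HiggsLattice.VecField P 0) {ι : Type*} (s : Finset ι)
    (w : ι → ScalarField P 0 N) (b : HiggsLattice.PBond P 0) :
    covDeriv C A (∑ i ∈ s, w i) b = ∑ i ∈ s, covDeriv C A (w i) b := by
  classical
  induction s using Finset.induction_on with
  | empty => rw [Finset.sum_empty, Finset.sum_empty, covDeriv_zero'']
  | insert i s hi ih => rw [Finset.sum_insert hi, Finset.sum_insert hi, covDeriv_add'', ih]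

/-- The norm of `(D^ε_A(fφ))(b)` through the coordinates of `φ`. [cite: Balaban1982Higgs1, (1.7) p.605] -/
theorem norm_covDeriv_apply_le_sum_coord {i : ℕ} (C : ChargeData N) (A : HiggsLattice.VecField P 0)
    (f : ScalarField P i N →ₗ[ℝ] ScalarField P 0 N) (φ : ScalarField P i N) (b : HiggsLattice.PBond P 0) :
    ‖covDeriv C A (f φ) b‖ ≤ ∑ s : HiggsLattice.Site P i × Ix N,
      |fieldCoord (E N) (HiggsLattice.Site P i) φ s| * ‖covDeriv C A (f (cb P N i s)) b‖ := by
  have h : f φ = ∑ s : HiggsLattice.Site P i × Ix N, fieldCoord (E N) (HiggsLattice.Site P i) φ s • f (cb P N i s) := by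
    conv_lhs => rw [← (cb P N i).sum_repr φ]
    rw [map_sum]
    refine Finset.sum_congr rfl fun s _ => ?_
    rw [map_smul, cb_repr]
  rw [h, covDeriv_sum'']
  refine (norm_sum_le _ _).trans (Finset.sum_le_sum fun s _ => ?_)
  rw [covDeriv_smul'', norm_smul, Real.norm_eq_abs]

/-- `‖Q_l^*(A)ψ(x)‖ = ‖ψ(x_l)‖` (the transports are unitary). [cite: Balaban1982Higgs1, (2.11) p.609] -/
theorem norm_avgQkAdj_apply' (C : ChargeData N) (A : HiggsLattice.VecField P 0) (l : ℕ) (ψ : ScalarField P l N)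
    (x : HiggsLattice.Site P 0) : ‖avgQkAdj C A l ψ x‖ = ‖ψ (blockIter l x)‖ := by
  rw [B1Ineq234Concrete.avgQkAdj_apply']
  exact ContinuousLinearMap.norm_map_of_mem_unitary (Unitary.star_mem (C.U_mem_unitary _ _)) _

/-- `L^lε = L^l·ε`. [cite: Balaban1982Higgs1, (1.19) p.607] -/
theorem mesh_eq_pow_mul (P : HiggsLattice.Params) (l : ℕ) : P.mesh l = (P.L : ℝ) ^ l * P.mesh 0 := by
  unfold HiggsLattice.Params.mesh; ring

/-- `L^lε ≤ L^kε` for `l ≤ k`. [cite: Balaban1982Higgs1, (1.19) p.607] -/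
theorem mesh_mono (P : HiggsLattice.Params) {l k : ℕ} (h : l ≤ k) : P.mesh l ≤ P.mesh k := by
  rw [mesh_eq_pow_mul P l, mesh_eq_pow_mul P k]
  exact mul_le_mul_of_nonneg_right (pow_le_pow_right₀ (Nat.one_le_cast.mpr P.hL) h) (P.mesh_pos 0).le

end Algebra

/-! ## §1 The covariant scale pieces `G^η_{(j)}(T_ε, A)` of (2.6) and the identity (2.6) -/

section Pieces

variable (C : ChargeData N) (A : HiggsLattice.VecField P 0) (msq a : ℝ)

/-- The unscaled sandwich `G^ε_j(T_ε,A)Q_j^*(A)C^{(j),L^jε}(T_ε,A)Q_j(A)G^ε_j(T_ε,A)` of the `j`-th term of (I.2.43).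
[cite: Balaban1982Higgs1, (2.43) p.612] -/
def sandwich (j : ℕ) : ScalarField P 0 N →ₗ[ℝ] ScalarField P 0 N :=
  propagatorK C Finset.univ A msq a j ∘ₗ avgQkAdj C A j ∘ₗ fluctCovA C Finset.univ A msq a j ∘ₗ avgQkLin C A j
    ∘ₗ propagatorK C Finset.univ A msq a j

/-- The `j`-th term of (I.2.43) at the external field `A` on the torus (`1 ≤ j`):
`a_j²(L^jε)^{−4}·G^ε_j(T_ε,A)Q_j^*(A)C^{(j),L^jε}(T_ε,A)Q_j(A)G^ε_j(T_ε,A)`. [cite: Balaban1982Higgs1, (2.43) p.612] -/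
def termA (j : ℕ) : ScalarField P 0 N →ₗ[ℝ] ScalarField P 0 N :=
  (coeff221 P a j ^ 2) • sandwich C A msq a j

/-- **The scale pieces of (2.6) on the torus `Ω = T_η` at the background `B̃ = A`**: `G^η_{(0)} = G^ε_1(T_ε,A) = C^{(0),ε}(T_ε,A)`,
`G^η_{(j)} =` the `j`-th term of (I.2.43) for `1 ≤ j < k`, and `0` beyond. [cite: Balaban1983Higgs3, (2.6) p.424] -/
def pieceA (k j : ℕ) : ScalarField P 0 N →ₗ[ℝ] ScalarField P 0 N :=
  if j = 0 then propagatorK C Finset.univ A msq a 1 else if j < k then termA C A msq a j else 0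

variable {C A msq a}

/-- `G^η_{(0)} = G^ε_1(T_ε, A)`. [cite: Balaban1983Higgs3, (2.6) p.424] -/
theorem pieceA_zero (k : ℕ) : pieceA C A msq a k 0 = propagatorK C Finset.univ A msq a 1 := by simp [pieceA]

/-- `G^η_{(j)} = term_j` for `1 ≤ j < k`. [cite: Balaban1983Higgs3, (2.6) p.424] -/
theorem pieceA_of_pos {k j : ℕ} (hj1 : 1 ≤ j) (hjk : j < k) : pieceA C A msq a k j = termA C A msq a j := by
  unfold pieceA; rw [if_neg (by omega), if_pos hjk]

/-- no pieces beyond `j = k − 1`. [cite: Balaban1983Higgs3, (2.6) p.424] -/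
theorem pieceA_of_le {k j : ℕ} (hj1 : 1 ≤ j) (hkj : k ≤ j) : pieceA C A msq a k j = 0 := by
  unfold pieceA; rw [if_neg (by omega), if_neg (by omega)]

/-- **(2.6) for the torus at the background `A`**: `Σ_{j=0}^{k−1} G^η_{(j)} = G^ε_k(T_ε, A)` — Bałaban's (I.2.43) for the concrete
covariant operators (`B1Eq243HiggsModel.display243_univ`, m² ≥ 0, a > 0, L > 1, 1 ≤ k ≤ K). [cite: Balaban1983Higgs3, (2.6) p.424]
[cite: Balaban1982Higgs1, (2.43) p.612] -/
theorem sum_pieceA (hm : 0 ≤ msq) (ha : 0 < a) (hL1 : 1 < P.L) {k : ℕ} (hk : 1 ≤ k) (hkK : k ≤ P.K) :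
    ∑ j ∈ Finset.range k, pieceA C A msq a k j = propagatorK C Finset.univ A msq a k := by
  have hL : 1 < (P.L : ℝ) := by exact_mod_cast hL1
  obtain ⟨n, rfl⟩ : ∃ n, k = n + 1 := ⟨k - 1, by omega⟩
  rw [Finset.sum_range_succ', pieceA_zero, B1Eq243HiggsModel.display243_univ C A hm ha hL hk hkK,
    B1Eq243HiggsModel.propagatorK_one C Finset.univ A hL msq a, Finset.sum_Ico_eq_sum_range]
  congr 1
  refine Finset.sum_congr (by simp) fun i hi => ?_
  have hi' := Finset.mem_range.1 hi
  rw [pieceA_of_pos (by omega) (by omega), add_comm]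
  rfl

end Pieces

/-! ## §2 Geometry: fine distance below the block-label distance, `|x − x′| ≤ L^l·|x_l − x′_l| + (L^l − 1)` -/

section Geometry

/-- One coordinate: circular distance of labels vs circular distance of their `T`-fold quotients,
`dist(a − b) ≤ T·dist(A − B) + (T − 1)`. [cite: Balaban1982Higgs1, (1.20) p.607] -/
private theorem coord_fine_le_pow {n m T : ℕ} [NeZero n] [NeZero m] (hn : n = T * m) (hT : 0 < T)
    (a b : ZMod n) (A B : ZMod m) (hA : A.val = a.val / T) (hB : B.val = b.val / T) :
    min (a - b).val (b - a).val ≤ T * min (A - B).val (B - A).val + (T - 1) := by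
  -- WLOG `b.val ≤ a.val`
  wlog hba : b.val ≤ a.val generalizing a b A B
  · have h := this b a B A hB hA (le_of_not_ge hba)
    rwa [min_comm, min_comm (B - A).val] at h
  have hBA : B.val ≤ A.val := by rw [hA, hB]; exact Nat.div_le_div_right hba
  -- linear facts about the quotients
  have ha1 : T * A.val ≤ a.val := by rw [hA, mul_comm]; exact Nat.div_mul_le_self _ _
  have ha2 : a.val < T * A.val + T := by rw [hA, mul_comm]; exact Nat.lt_div_mul_add hT
  have hb1 : T * B.val ≤ b.val := by rw [hB, mul_comm]; exact Nat.div_mul_le_self _ _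
  have hb2 : b.val < T * B.val + T := by rw [hB, mul_comm]; exact Nat.lt_div_mul_add hT
  have hab : (a - b).val = a.val - b.val := ZMod.val_sub hba
  have hAB : (A - B).val = A.val - B.val := ZMod.val_sub hBA
  by_cases hAeq : A = B
  · -- same block: `a − b ≤ T − 1`
    subst hAeq
    have h0 : (A - A).val = 0 := by rw [sub_self, ZMod.val_zero]
    rw [h0, min_self, mul_zero, zero_add]
    refine (min_le_left _ _).trans ?_
    rw [hab]; omega
  · have hAne : A.val ≠ B.val := fun h => hAeq (ZMod.val_injective _ h)
    have habne : a ≠ b := by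
      intro h; apply hAne; rw [hA, hB, h]
    have hba' : (b - a).val = n - (a.val - b.val) := by
      rw [← neg_sub, ZMod.neg_val, if_neg (sub_ne_zero.mpr habne), hab]
    have hBA' : (B - A).val = m - (A.val - B.val) := by
      rw [← neg_sub, ZMod.neg_val, if_neg (sub_ne_zero.mpr hAeq), hAB]
    set u := T * A.val with hu
    set v := T * B.val with hv
    have h1 : (a - b).val ≤ T * (A - B).val + (T - 1) := by
      rw [hab, hAB, mul_tsub, ← hu, ← hv]; omega
    have h2 : (b - a).val ≤ T * (B - A).val + (T - 1) := by
      rw [hba', hBA', mul_tsub, mul_tsub, ← hn, ← hu, ← hv]; omega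
    rcases le_total (A - B).val (B - A).val with h | h
    · rw [min_eq_left h]; exact (min_le_left _ _).trans h1
    · rw [min_eq_right h]; exact (min_le_right _ _).trans h2

/-- **FINE BELOW COARSE, `l` levels**: `|x − x′| ≤ L^l·|x_l − x′_l| + (L^l − 1)` for `x, x′ ∈ T_ε`, `l ≤ K` (two points of `T_ε` lying in
`L^l`-blocks whose labels are `D` apart are at most `L^l·D + L^l − 1` apart; distance (1.3) in lattice units).
[cite: Balaban1982Higgs1, (1.20) p.607] -/
theorem tdist_le_pow_mul_tdist_blockIter {l : ℕ} (hl : l ≤ P.K) (x x' : HiggsLattice.Site P 0) :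
    HiggsLattice.Site.tdist x x' ≤ P.L ^ l * HiggsLattice.Site.tdist (blockIter l x) (blockIter l x') + (P.L ^ l - 1) := by
  unfold HiggsLattice.Site.tdist
  refine Finset.sup_le fun μ _ => ?_
  have hT : 0 < P.L ^ l := pow_pos (by have := P.hL; omega) l
  have h := coord_fine_le_pow (B2Ineq329ZeroAveraging.sitesPerDir_zero_eq hl μ) hT (x μ) (x' μ)
    ((blockIter l x) μ) ((blockIter l x') μ) (val_blockIter_all l x μ) (val_blockIter_all l x' μ)
  refine h.trans (Nat.add_le_add_right (Nat.mul_le_mul_left _ ?_) _)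
  exact Finset.le_sup (f := fun ν : Fin P.d => min ((blockIter l x) ν - (blockIter l x') ν).val
    ((blockIter l x') ν - (blockIter l x) ν).val) (Finset.mem_univ μ)

end Geometry

/-! ## §3 The engine: the kernel of one sandwich `G^ε_lQ_l^*C^{(l)}Q_lG^ε_l` from the three located inputs

At one level `1 ≤ l ≤ K` the three inputs are taken as hypotheses in the shape the tree's theorems print them:
`hG` = the (I.2.25) value clause with its decay factor for `G^ε_l(T_ε, A)` (p35's `norm_propagatorK_reg_decay`),
`hDG` = the (I.2.25) derivative clause (p35's `norm_covDeriv_propagatorK_reg_decay`), `hC` = the (I.2.34) kernel bound of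
`C^{(l),L^lε}(T_ε, A)` (r14's `ineq234_236_regular_torus`).  From them: the value at `x` and the covariant derivative at `b` of
`G^ε_lQ_l^*C^{(l)}Q_lG^ε_l e_q` decay like `e^{−(δ/2)|x − x_q|/L^l}` with the factor `L^{−ld}` (three-kernel convolution; the
adjointness `(Q_lG^ε_l)^* = G^ε_lQ_l^*` for the products (1.5) supplies `L^{−ld}`). -/

section Engine

variable (C : ChargeData N) (A : HiggsLattice.VecField P 0) (msq a : ℝ) {l : ℕ}

/-- `X(p, q) = δ_p · X δ_q` for any real matrix. [folklore] -/
private theorem entry_eq_dotProduct {m n : Type*} [Fintype m] [Fintype n] [DecidableEq m] [DecidableEq n] (X : Matrix m n ℝ)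
    (p : m) (q : n) : X p q = Pi.single p (1 : ℝ) ⬝ᵥ (X *ᵥ Pi.single q (1 : ℝ)) := by
  rw [single_dotProduct, one_mul, Matrix.mulVec, dotProduct_single, mul_one]

/-- The source `Q_l^*(A)e_s` has sup norm `≤ √N`. [cite: Balaban1982Higgs1, (2.11) p.609] -/
theorem norm_avgQkAdj_cb_le (s : HiggsLattice.Site P l × Ix N) (z : HiggsLattice.Site P 0) :
    ‖avgQkAdj C A l (cb P N l s) z‖ ≤ Real.sqrt N := by
  rw [norm_avgQkAdj_apply']
  exact norm_cb_le s _

/-- The source `Q_l^*(A)e_s` is supported in the block `B^l(y_s)`. [cite: Balaban1982Higgs1, (2.11) p.609] -/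
theorem blockIter_eq_of_avgQkAdj_cb_ne_zero (s : HiggsLattice.Site P l × Ix N) {z : HiggsLattice.Site P 0}
    (hz : avgQkAdj C A l (cb P N l s) z ≠ 0) : blockIter l z = s.1 := by
  by_contra h
  exact hz (B1Ineq234Concrete.avgQkAdj_cb_eq_zero C A s h)

/-- The distance from `x` to the block `B^l(y)`: every `z` with `z_l = y` has `|x − z| ≥ L^l|x_l − y| − (L^l − 1)`
(`B1Ineq234Concrete.tdist_blockIter_le_real`). [cite: Balaban1982Higgs1, (1.20) p.607] -/
theorem blockDist_le_tdist (hl : l ≤ P.K) (x : HiggsLattice.Site P 0) (y : HiggsLattice.Site P l) {z : HiggsLattice.Site P 0}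
    (hz : blockIter l z = y) :
    max 0 ((P.L : ℝ) ^ l * (HiggsLattice.Site.tdist (blockIter l x) y : ℝ) - ((P.L : ℝ) ^ l - 1))
      ≤ (HiggsLattice.Site.tdist x z : ℝ) := by
  refine max_le (Nat.cast_nonneg _) ?_
  have hT : (0 : ℝ) < (P.L : ℝ) ^ l := pow_pos (by exact_mod_cast P.hL) l
  have h := tdist_blockIter_le_real hl x z
  rw [hz] at h
  have := mul_le_mul_of_nonneg_left h hT.le
  have e : (P.L : ℝ) ^ l * ((HiggsLattice.Site.tdist x z : ℝ) / (P.L : ℝ) ^ l + 1 - ((P.L : ℝ) ^ l)⁻¹)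
      = (HiggsLattice.Site.tdist x z : ℝ) + ((P.L : ℝ) ^ l - 1) := by
    field_simp
    ring
  linarith

/-- The decay factor at the block distance: `e^{−δD/L^l} ≤ e^{δ}e^{−δ|x_l − y|}` for `D ≥ L^l|x_l − y| − (L^l − 1)`. [folklore] -/
private theorem exp_blockDist_le (x : HiggsLattice.Site P 0) (y : HiggsLattice.Site P l) {δ : ℝ} (hδ : 0 ≤ δ) :
    Real.exp (-(δ * (max 0 ((P.L : ℝ) ^ l * (HiggsLattice.Site.tdist (blockIter l x) y : ℝ) - ((P.L : ℝ) ^ l - 1))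
        / (P.L : ℝ) ^ l)))
      ≤ Real.exp δ * Real.exp (-(δ * (HiggsLattice.Site.tdist (blockIter l x) y : ℝ))) := by
  rw [← Real.exp_add]
  apply Real.exp_le_exp.mpr
  have hT : (0 : ℝ) < (P.L : ℝ) ^ l := pow_pos (by exact_mod_cast P.hL) l
  set t : ℝ := (HiggsLattice.Site.tdist (blockIter l x) y : ℝ) with ht
  have h2 : t - 1 ≤ max 0 ((P.L : ℝ) ^ l * t - ((P.L : ℝ) ^ l - 1)) / (P.L : ℝ) ^ l := by
    rw [le_div_iff₀ hT]
    have h1 : (P.L : ℝ) ^ l * t - ((P.L : ℝ) ^ l - 1) ≤ max 0 ((P.L : ℝ) ^ l * t - ((P.L : ℝ) ^ l - 1)) :=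
      le_max_right _ _
    nlinarith
  nlinarith [mul_le_mul_of_nonneg_left h2 hδ]

/-- **First kernel** — `‖(G^ε_lQ_l^*e_s)(x)‖ ≤ c_G·e^{δ}·e^{−δ|x_l − y_s|}·√N` from the (I.2.25) value clause at level `l`.
[cite: Balaban1982Higgs1, Prop. 2.1 (2.25) p.610] -/
theorem norm_G_avgQkAdj_cb_le (hl : l ≤ P.K) {cG δ : ℝ} (hcG : 0 ≤ cG) (hδ : 0 ≤ δ)
    (hG : ∀ (g : ScalarField P 0 N) (M D : ℝ), (∀ x, ‖g x‖ ≤ M) → 0 ≤ D →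
      ∀ x, (∀ z, g z ≠ 0 → D ≤ (HiggsLattice.Site.tdist x z : ℝ)) →
        ‖propagatorK C Finset.univ A msq a l g x‖ ≤ cG * Real.exp (-(δ * (D / (P.L : ℝ) ^ l))) * M)
    (s : HiggsLattice.Site P l × Ix N) (x : HiggsLattice.Site P 0) :
    ‖propagatorK C Finset.univ A msq a l (avgQkAdj C A l (cb P N l s)) x‖
      ≤ cG * Real.exp δ * Real.exp (-(δ * (HiggsLattice.Site.tdist (blockIter l x) s.1 : ℝ))) * Real.sqrt N := by
  set D : ℝ := max 0 ((P.L : ℝ) ^ l * (HiggsLattice.Site.tdist (blockIter l x) s.1 : ℝ) - ((P.L : ℝ) ^ l - 1)) with hD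
  have h := hG (avgQkAdj C A l (cb P N l s)) (Real.sqrt N) D (norm_avgQkAdj_cb_le C A s) (le_max_left _ _) x
    (fun z hz => blockDist_le_tdist hl x s.1 (blockIter_eq_of_avgQkAdj_cb_ne_zero C A s hz))
  refine h.trans ?_
  have he := exp_blockDist_le (P := P) x s.1 hδ
  have hs : 0 ≤ Real.sqrt (N : ℝ) := Real.sqrt_nonneg _
  calc cG * Real.exp (-(δ * (D / (P.L : ℝ) ^ l))) * Real.sqrt N
      ≤ cG * (Real.exp δ * Real.exp (-(δ * (HiggsLattice.Site.tdist (blockIter l x) s.1 : ℝ)))) * Real.sqrt N :=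
        mul_le_mul_of_nonneg_right (mul_le_mul_of_nonneg_left he hcG) hs
    _ = _ := by ring

/-- **First kernel, differentiated** — `‖(D^ε_AG^ε_lQ_l^*e_s)(b)‖ ≤ c_D·e^{δ}·e^{−δ|(b₋)_l − y_s|}·√N` from the (I.2.25) derivative clause.
[cite: Balaban1982Higgs1, Prop. 2.1 (2.25) p.610] -/
theorem norm_covDeriv_G_avgQkAdj_cb_le (hl : l ≤ P.K) {cD δ : ℝ} (hcD : 0 ≤ cD) (hδ : 0 ≤ δ)
    (hDG : ∀ (g : ScalarField P 0 N) (M D : ℝ), (∀ x, ‖g x‖ ≤ M) → 0 ≤ D →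
      ∀ b : HiggsLattice.PBond P 0, (∀ z, g z ≠ 0 → D ≤ (HiggsLattice.Site.tdist b.src z : ℝ)) →
        ‖covDeriv C A (propagatorK C Finset.univ A msq a l g) b‖ ≤ cD * Real.exp (-(δ * (D / (P.L : ℝ) ^ l))) * M)
    (s : HiggsLattice.Site P l × Ix N) (b : HiggsLattice.PBond P 0) :
    ‖covDeriv C A (propagatorK C Finset.univ A msq a l (avgQkAdj C A l (cb P N l s))) b‖
      ≤ cD * Real.exp δ * Real.exp (-(δ * (HiggsLattice.Site.tdist (blockIter l b.src) s.1 : ℝ))) * Real.sqrt N := by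
  set D : ℝ := max 0 ((P.L : ℝ) ^ l * (HiggsLattice.Site.tdist (blockIter l b.src) s.1 : ℝ) - ((P.L : ℝ) ^ l - 1)) with hD
  have h := hDG (avgQkAdj C A l (cb P N l s)) (Real.sqrt N) D (norm_avgQkAdj_cb_le C A s) (le_max_left _ _) b
    (fun z hz => blockDist_le_tdist hl b.src s.1 (blockIter_eq_of_avgQkAdj_cb_ne_zero C A s hz))
  refine h.trans ?_
  have he := exp_blockDist_le (P := P) b.src s.1 hδ
  have hs : 0 ≤ Real.sqrt (N : ℝ) := Real.sqrt_nonneg _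
  calc cD * Real.exp (-(δ * (D / (P.L : ℝ) ^ l))) * Real.sqrt N
      ≤ cD * (Real.exp δ * Real.exp (-(δ * (HiggsLattice.Site.tdist (blockIter l b.src) s.1 : ℝ)))) * Real.sqrt N :=
        mul_le_mul_of_nonneg_right (mul_le_mul_of_nonneg_left he hcD) hs
    _ = _ := by ring

/-- `Q_l(A)G^ε_l` and `G^ε_lQ_l^*(A)` are adjoint for the products (1.5) of `T_ε` and `T^{(l)}` (adjointness (2.20) and the symmetry of
`G^ε_l(T_ε, A)`). [cite: Balaban1982Higgs1, (2.20) p.610] -/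
theorem siteInner_QG_adjoint (f : ScalarField P 0 N) (g : ScalarField P l N) :
    siteInner ((avgQkLin C A l ∘ₗ propagatorK C Finset.univ A msq a l) f) g
      = siteInner f ((propagatorK C Finset.univ A msq a l ∘ₗ avgQkAdj C A l) g) := by
  rw [LinearMap.comp_apply, LinearMap.comp_apply, siteInner_avgQkLin, HiggsFluctMeasurePos.siteInner_comm,
    siteInner_propagatorK_comm C Finset.univ A msq a l f]

/-- **The adjoint relation of the coordinate kernels**: `(Q_lG^ε_l)(t, q) = L^{−ld}·(G^ε_lQ_l^*)(q, t)` (the weights `ε^d` of `T_ε`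
and `(L^lε)^d` of `T^{(l)}` in (1.5)). [cite: Balaban1982Higgs1, (1.5) p.604, (2.20) p.610] -/
theorem mat_QG_eq (t : HiggsLattice.Site P l × Ix N) (q : HiggsLattice.Site P 0 × Ix N) :
    mat (avgQkLin C A l ∘ₗ propagatorK C Finset.univ A msq a l) t q
      = (((P.L : ℝ) ^ l) ^ P.d)⁻¹ * mat (propagatorK C Finset.univ A msq a l ∘ₗ avgQkAdj C A l) q t := by
  have h := adjoint_transfer (X := avgQkLin C A l ∘ₗ propagatorK C Finset.univ A msq a l)
    (Xs := propagatorK C Finset.univ A msq a l ∘ₗ avgQkAdj C A l) (siteInner_QG_adjoint C A msq a)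
    (Pi.single q 1) (Pi.single t 1)
  rw [dotProduct_wt_mulVec, dotProduct_wt_mulVec, ← entry_eq_dotProduct, dotProduct_comm, ← entry_eq_dotProduct,
    mesh_eq_pow_mul P l, mul_pow] at h
  have hm : (0 : ℝ) < P.mesh 0 ^ P.d := pow_pos (P.mesh_pos 0) _
  have hL : (0 : ℝ) < ((P.L : ℝ) ^ l) ^ P.d := pow_pos (pow_pos (by exact_mod_cast P.hL) l) _
  rw [eq_inv_mul_iff_mul_eq₀ hL.ne']
  -- `h : ε^d·(GQ^*)(q,t) = (L^l)^d·ε^d·(QG)(t,q)`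
  have h' : P.mesh 0 ^ P.d * (((P.L : ℝ) ^ l) ^ P.d * mat (avgQkLin C A l ∘ₗ propagatorK C Finset.univ A msq a l) t q)
      = P.mesh 0 ^ P.d * mat (propagatorK C Finset.univ A msq a l ∘ₗ avgQkAdj C A l) q t := by
    rw [h]; ring
  exact mul_left_cancel₀ hm.ne' h'

/-- **Third kernel** — `|(Q_lG^ε_l)(t, q)| ≤ L^{−ld}·c_G·e^{δ}·e^{−δ|(x_q)_l − y_t|}·√N`. [cite: Balaban1982Higgs1, Prop. 2.1 (2.25) p.610, (2.20) p.610] -/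
theorem abs_mat_QG_le (hl : l ≤ P.K) {cG δ : ℝ} (hcG : 0 ≤ cG) (hδ : 0 ≤ δ)
    (hG : ∀ (g : ScalarField P 0 N) (M D : ℝ), (∀ x, ‖g x‖ ≤ M) → 0 ≤ D →
      ∀ x, (∀ z, g z ≠ 0 → D ≤ (HiggsLattice.Site.tdist x z : ℝ)) →
        ‖propagatorK C Finset.univ A msq a l g x‖ ≤ cG * Real.exp (-(δ * (D / (P.L : ℝ) ^ l))) * M)
    (t : HiggsLattice.Site P l × Ix N) (q : HiggsLattice.Site P 0 × Ix N) :
    |mat (avgQkLin C A l ∘ₗ propagatorK C Finset.univ A msq a l) t q|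
      ≤ (((P.L : ℝ) ^ l) ^ P.d)⁻¹ *
        (cG * Real.exp δ * Real.exp (-(δ * (HiggsLattice.Site.tdist (blockIter l q.1) t.1 : ℝ))) * Real.sqrt N) := by
  have hL : (0 : ℝ) ≤ (((P.L : ℝ) ^ l) ^ P.d)⁻¹ := inv_nonneg.mpr (pow_nonneg (pow_nonneg (Nat.cast_nonneg _) l) _)
  rw [mat_QG_eq, abs_mul, abs_of_nonneg hL]
  refine mul_le_mul_of_nonneg_left ?_ hL
  refine (abs_mat_le_norm _ q t).trans ?_
  rw [LinearMap.comp_apply]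
  exact norm_G_avgQkAdj_cb_le C A msq a hl hcG hδ hG t q.1

/-- **The coordinates of `C^{(l)}Q_lG^ε_le_q`**: `|(C^{(l)}Q_lG^ε_le_q)_s| ≤ Σ_t |C^{(l)}(s,t)|·|(Q_lG^ε_l)(t,q)|`. [cite: Balaban1982Higgs1, (2.43) p.612] -/
theorem abs_coord_CQG_le (s : HiggsLattice.Site P l × Ix N) (q : HiggsLattice.Site P 0 × Ix N) :
    |fieldCoord (E N) (HiggsLattice.Site P l)
        (fluctCovA C Finset.univ A msq a l (avgQkLin C A l (propagatorK C Finset.univ A msq a l (cb P N 0 q)))) s|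
      ≤ ∑ t : HiggsLattice.Site P l × Ix N, |mat (fluctCovA C Finset.univ A msq a l) s t| *
          |mat (avgQkLin C A l ∘ₗ propagatorK C Finset.univ A msq a l) t q| := by
  have h : fieldCoord (E N) (HiggsLattice.Site P l)
        (fluctCovA C Finset.univ A msq a l (avgQkLin C A l (propagatorK C Finset.univ A msq a l (cb P N 0 q)))) s
      = mat (fluctCovA C Finset.univ A msq a l ∘ₗ (avgQkLin C A l ∘ₗ propagatorK C Finset.univ A msq a l)) s q := by
    rw [B2Eq246ScalarStep.mat_apply]; rfl
  rw [h, mat_comp, Matrix.mul_apply]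
  exact (Finset.abs_sum_le_sum_abs _ _).trans (le_of_eq (Finset.sum_congr rfl fun t _ => abs_mul _ _))

/-- **The three-kernel convolution on `T^{(l)}`**: `Σ_{s,t} e^{−δ|u − y_s|}e^{−δ|y_s − y_t|}e^{−δ|v − y_t|} ≤ K(δ/2)²·e^{−(δ/2)|u − v|}`,
sums over the coordinate indices of `T^{(l)}`, `K = N·K_d` the uniform torus-sum profile (`B1Ineq234Concrete.rho_sumBound`).
[cite: Balaban1983RegularityDecay, Sect. 5 Theorem p.594] -/
theorem sum3_le {δ : ℝ} (hδ : 0 < δ) (u v : HiggsLattice.Site P l) (i₀ : Ix N) :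
    ∑ s : HiggsLattice.Site P l × Ix N, ∑ t : HiggsLattice.Site P l × Ix N,
        Real.exp (-(δ * (HiggsLattice.Site.tdist u s.1 : ℝ))) * Real.exp (-(δ * (HiggsLattice.Site.tdist s.1 t.1 : ℝ))) *
          Real.exp (-(δ * (HiggsLattice.Site.tdist v t.1 : ℝ)))
      ≤ profile P N (δ / 2) ^ 2 * Real.exp (-(δ / 2 * (HiggsLattice.Site.tdist u v : ℝ))) := by
  have hδ2 : 0 < δ / 2 := by linarith
  -- termwise: split the rate and use the triangle inequality
  have hterm : ∀ s t : HiggsLattice.Site P l × Ix N,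
      Real.exp (-(δ * (HiggsLattice.Site.tdist u s.1 : ℝ))) * Real.exp (-(δ * (HiggsLattice.Site.tdist s.1 t.1 : ℝ))) *
          Real.exp (-(δ * (HiggsLattice.Site.tdist v t.1 : ℝ)))
        ≤ Real.exp (-(δ / 2 * (HiggsLattice.Site.tdist u v : ℝ))) *
          (Real.exp (-(δ / 2 * (HiggsLattice.Site.tdist u s.1 : ℝ))) * Real.exp (-(δ / 2 * (HiggsLattice.Site.tdist s.1 t.1 : ℝ)))) := by
    intro s t
    rw [← Real.exp_add, ← Real.exp_add, ← Real.exp_add, ← Real.exp_add]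
    apply Real.exp_le_exp.mpr
    have h1 := tdist_triangle_real u s.1 t.1
    have h2 := tdist_triangle_real u t.1 v
    rw [tdist_comm t.1 v] at h2
    have h0 : (0 : ℝ) ≤ (HiggsLattice.Site.tdist v t.1 : ℝ) := Nat.cast_nonneg _
    have ha : (0 : ℝ) ≤ (HiggsLattice.Site.tdist u s.1 : ℝ) := Nat.cast_nonneg _
    have hb : (0 : ℝ) ≤ (HiggsLattice.Site.tdist s.1 t.1 : ℝ) := Nat.cast_nonneg _
    nlinarith
  -- the row sums
  have hrow : ∀ s : HiggsLattice.Site P l × Ix N,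
      ∑ t : HiggsLattice.Site P l × Ix N, Real.exp (-(δ / 2 * (HiggsLattice.Site.tdist s.1 t.1 : ℝ))) ≤ profile P N (δ / 2) := by
    intro s
    have h := rho_sumBound (P := P) (N := N) (k := l) (δ / 2) hδ2 s
    simp_rw [rho_eq_tdist] at h
    exact h
  have hrow0 : ∑ s : HiggsLattice.Site P l × Ix N, Real.exp (-(δ / 2 * (HiggsLattice.Site.tdist u s.1 : ℝ)))
      ≤ profile P N (δ / 2) := by
    have h := rho_sumBound (P := P) (N := N) (k := l) (δ / 2) hδ2 (u, i₀)
    simp_rw [rho_eq_tdist] at h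
    exact h
  have hK : 0 ≤ profile P N (δ / 2) := profile_nonneg' _ hδ2
  calc ∑ s : HiggsLattice.Site P l × Ix N, ∑ t : HiggsLattice.Site P l × Ix N,
        Real.exp (-(δ * (HiggsLattice.Site.tdist u s.1 : ℝ))) * Real.exp (-(δ * (HiggsLattice.Site.tdist s.1 t.1 : ℝ))) *
          Real.exp (-(δ * (HiggsLattice.Site.tdist v t.1 : ℝ)))
      ≤ ∑ s : HiggsLattice.Site P l × Ix N, ∑ t : HiggsLattice.Site P l × Ix N,
          Real.exp (-(δ / 2 * (HiggsLattice.Site.tdist u v : ℝ))) *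
            (Real.exp (-(δ / 2 * (HiggsLattice.Site.tdist u s.1 : ℝ))) *
              Real.exp (-(δ / 2 * (HiggsLattice.Site.tdist s.1 t.1 : ℝ)))) :=
        Finset.sum_le_sum fun s _ => Finset.sum_le_sum fun t _ => hterm s t
    _ = Real.exp (-(δ / 2 * (HiggsLattice.Site.tdist u v : ℝ))) *
          ∑ s : HiggsLattice.Site P l × Ix N, (Real.exp (-(δ / 2 * (HiggsLattice.Site.tdist u s.1 : ℝ))) *
            ∑ t : HiggsLattice.Site P l × Ix N, Real.exp (-(δ / 2 * (HiggsLattice.Site.tdist s.1 t.1 : ℝ)))) := by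
        rw [Finset.mul_sum]
        refine Finset.sum_congr rfl fun s _ => ?_
        rw [Finset.mul_sum, Finset.mul_sum]
    _ ≤ Real.exp (-(δ / 2 * (HiggsLattice.Site.tdist u v : ℝ))) *
          ∑ s : HiggsLattice.Site P l × Ix N, (Real.exp (-(δ / 2 * (HiggsLattice.Site.tdist u s.1 : ℝ))) *
            profile P N (δ / 2)) := by
        refine mul_le_mul_of_nonneg_left (Finset.sum_le_sum fun s _ => ?_) (Real.exp_pos _).le
        exact mul_le_mul_of_nonneg_left (hrow s) (Real.exp_pos _).le
    _ ≤ Real.exp (-(δ / 2 * (HiggsLattice.Site.tdist u v : ℝ))) * (profile P N (δ / 2) * profile P N (δ / 2)) := by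
        rw [← Finset.sum_mul]
        exact mul_le_mul_of_nonneg_left (mul_le_mul_of_nonneg_right hrow0 hK) (Real.exp_pos _).le
    _ = _ := by ring

/-- Block labels back to the fine distance in the exponent: `e^{−(δ/2)|x_l − x′_l|} ≤ e^{δ/2}e^{−(δ/2)|x − x′|/L^l}` (§2).
[cite: Balaban1982Higgs1, (1.20) p.607] -/
theorem exp_blockIter_le (hl : l ≤ P.K) {δ : ℝ} (hδ : 0 ≤ δ) (x x' : HiggsLattice.Site P 0) :
    Real.exp (-(δ / 2 * (HiggsLattice.Site.tdist (blockIter l x) (blockIter l x') : ℝ)))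
      ≤ Real.exp (δ / 2) * Real.exp (-(δ / 2 * ((HiggsLattice.Site.tdist x x' : ℝ) / (P.L : ℝ) ^ l))) := by
  rw [← Real.exp_add]
  apply Real.exp_le_exp.mpr
  have hT : (0 : ℝ) < (P.L : ℝ) ^ l := pow_pos (by exact_mod_cast P.hL) l
  have h := tdist_le_pow_mul_tdist_blockIter hl x x'
  have h1 : 1 ≤ P.L ^ l := Nat.one_le_pow _ _ P.hL
  have hcast : (HiggsLattice.Site.tdist x x' : ℝ) ≤
      (P.L : ℝ) ^ l * (HiggsLattice.Site.tdist (blockIter l x) (blockIter l x') : ℝ) + ((P.L : ℝ) ^ l - 1) := by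
    have := (Nat.cast_le (α := ℝ)).mpr h
    rw [Nat.cast_add, Nat.cast_mul, Nat.cast_sub h1, Nat.cast_pow, Nat.cast_one] at this
    exact this
  have h2 : (HiggsLattice.Site.tdist x x' : ℝ) / (P.L : ℝ) ^ l ≤
      (HiggsLattice.Site.tdist (blockIter l x) (blockIter l x') : ℝ) + 1 := by
    rw [div_le_iff₀ hT]
    nlinarith
  nlinarith

/-- **THE SANDWICH KERNEL (value)** — from the three inputs at level `l ≤ K` with a common rate `δ > 0`:
`‖(G^ε_lQ_l^*C^{(l)}Q_lG^ε_l e_q)(x)‖ ≤ (c_Ge^{δ}√N)²·c_C·L^{−ld}·K(δ/2)²·e^{δ/2}·e^{−(δ/2)|x − x_q|/L^l}` (coordinate expansion,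
the three kernels, the three-kernel convolution, block labels back to the fine distance).
[cite: Balaban1982Higgs1, (2.43) p.612, Prop. 2.1 (2.25) p.610, Prop. 2.3 (2.34) p.611] -/
theorem norm_sandwich_cb_le (hl : l ≤ P.K) {cG cC δ : ℝ} (hcG : 0 ≤ cG) (hcC : 0 ≤ cC) (hδ : 0 < δ)
    (hG : ∀ (g : ScalarField P 0 N) (M D : ℝ), (∀ x, ‖g x‖ ≤ M) → 0 ≤ D →
      ∀ x, (∀ z, g z ≠ 0 → D ≤ (HiggsLattice.Site.tdist x z : ℝ)) →
        ‖propagatorK C Finset.univ A msq a l g x‖ ≤ cG * Real.exp (-(δ * (D / (P.L : ℝ) ^ l))) * M)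
    (hC : ∀ s t : HiggsLattice.Site P l × Ix N,
      |mat (fluctCovA C Finset.univ A msq a l) s t| ≤ cC * Real.exp (-(δ * (HiggsLattice.Site.tdist s.1 t.1 : ℝ))))
    (q : HiggsLattice.Site P 0 × Ix N) (x : HiggsLattice.Site P 0) :
    ‖sandwich C A msq a l (cb P N 0 q) x‖
      ≤ (cG * Real.exp δ * Real.sqrt N) ^ 2 * cC * (((P.L : ℝ) ^ l) ^ P.d)⁻¹ * profile P N (δ / 2) ^ 2 *
          Real.exp (δ / 2) * Real.exp (-(δ / 2 * ((HiggsLattice.Site.tdist x q.1 : ℝ) / (P.L : ℝ) ^ l))) := by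
  have h0 : sandwich C A msq a l (cb P N 0 q) = (propagatorK C Finset.univ A msq a l ∘ₗ avgQkAdj C A l)
      (fluctCovA C Finset.univ A msq a l (avgQkLin C A l (propagatorK C Finset.univ A msq a l (cb P N 0 q)))) := by
    simp only [sandwich, LinearMap.comp_apply]
  rw [h0]
  refine (norm_apply_le_sum_coord _ _ x).trans ?_
  have hK : 0 ≤ profile P N (δ / 2) := profile_nonneg' _ (by linarith)
  calc ∑ s : HiggsLattice.Site P l × Ix N, |fieldCoord (E N) (HiggsLattice.Site P l)
            (fluctCovA C Finset.univ A msq a l (avgQkLin C A l (propagatorK C Finset.univ A msq a l (cb P N 0 q)))) s| *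
          ‖(propagatorK C Finset.univ A msq a l ∘ₗ avgQkAdj C A l) (cb P N l s) x‖
      ≤ ∑ s : HiggsLattice.Site P l × Ix N,
          (∑ t : HiggsLattice.Site P l × Ix N, cC * Real.exp (-(δ * (HiggsLattice.Site.tdist s.1 t.1 : ℝ))) *
            ((((P.L : ℝ) ^ l) ^ P.d)⁻¹ *
              (cG * Real.exp δ * Real.exp (-(δ * (HiggsLattice.Site.tdist (blockIter l q.1) t.1 : ℝ))) * Real.sqrt N))) *
          (cG * Real.exp δ * Real.exp (-(δ * (HiggsLattice.Site.tdist (blockIter l x) s.1 : ℝ))) * Real.sqrt N) := by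
        refine Finset.sum_le_sum fun s _ => ?_
        have h1 : |fieldCoord (E N) (HiggsLattice.Site P l)
              (fluctCovA C Finset.univ A msq a l (avgQkLin C A l (propagatorK C Finset.univ A msq a l (cb P N 0 q)))) s|
            ≤ ∑ t : HiggsLattice.Site P l × Ix N, cC * Real.exp (-(δ * (HiggsLattice.Site.tdist s.1 t.1 : ℝ))) *
              ((((P.L : ℝ) ^ l) ^ P.d)⁻¹ *
                (cG * Real.exp δ * Real.exp (-(δ * (HiggsLattice.Site.tdist (blockIter l q.1) t.1 : ℝ))) * Real.sqrt N)) :=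
          (abs_coord_CQG_le C A msq a s q).trans (Finset.sum_le_sum fun t _ =>
            mul_le_mul (hC s t) (abs_mat_QG_le C A msq a hl hcG hδ.le hG t q) (abs_nonneg _) (by positivity))
        have h2 : ‖(propagatorK C Finset.univ A msq a l ∘ₗ avgQkAdj C A l) (cb P N l s) x‖
            ≤ cG * Real.exp δ * Real.exp (-(δ * (HiggsLattice.Site.tdist (blockIter l x) s.1 : ℝ))) * Real.sqrt N := by
          rw [LinearMap.comp_apply]
          exact norm_G_avgQkAdj_cb_le C A msq a hl hcG hδ.le hG s x
        exact mul_le_mul h1 h2 (norm_nonneg _) (Finset.sum_nonneg fun t _ => by positivity)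
    _ = (cG * Real.exp δ * Real.sqrt N) ^ 2 * cC * (((P.L : ℝ) ^ l) ^ P.d)⁻¹ *
          ∑ s : HiggsLattice.Site P l × Ix N, ∑ t : HiggsLattice.Site P l × Ix N,
            Real.exp (-(δ * (HiggsLattice.Site.tdist (blockIter l x) s.1 : ℝ))) *
              Real.exp (-(δ * (HiggsLattice.Site.tdist s.1 t.1 : ℝ))) *
              Real.exp (-(δ * (HiggsLattice.Site.tdist (blockIter l q.1) t.1 : ℝ))) := by
        rw [Finset.mul_sum]
        refine Finset.sum_congr rfl fun s _ => ?_
        rw [Finset.sum_mul, Finset.mul_sum]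
        refine Finset.sum_congr rfl fun t _ => ?_
        ring
    _ ≤ (cG * Real.exp δ * Real.sqrt N) ^ 2 * cC * (((P.L : ℝ) ^ l) ^ P.d)⁻¹ *
          (profile P N (δ / 2) ^ 2 *
            Real.exp (-(δ / 2 * (HiggsLattice.Site.tdist (blockIter l x) (blockIter l q.1) : ℝ)))) :=
        mul_le_mul_of_nonneg_left (sum3_le hδ (blockIter l x) (blockIter l q.1) q.2) (by positivity)
    _ ≤ (cG * Real.exp δ * Real.sqrt N) ^ 2 * cC * (((P.L : ℝ) ^ l) ^ P.d)⁻¹ *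
          (profile P N (δ / 2) ^ 2 * (Real.exp (δ / 2) *
            Real.exp (-(δ / 2 * ((HiggsLattice.Site.tdist x q.1 : ℝ) / (P.L : ℝ) ^ l))))) :=
        mul_le_mul_of_nonneg_left (mul_le_mul_of_nonneg_left (exp_blockIter_le hl hδ.le x q.1) (pow_nonneg hK 2))
          (by positivity)
    _ = _ := by ring

/-- **THE SANDWICH KERNEL (covariant derivative)** — the same with the (I.2.25) derivative clause on the first factor:
`‖(D^ε_A G^ε_lQ_l^*C^{(l)}Q_lG^ε_l e_q)(b)‖ ≤ (c_De^{δ}√N)(c_Ge^{δ}√N)·c_C·L^{−ld}·K(δ/2)²·e^{δ/2}·e^{−(δ/2)|b₋ − x_q|/L^l}`.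
[cite: Balaban1982Higgs1, (2.43) p.612, Prop. 2.1 (2.25) p.610, Prop. 2.3 (2.34) p.611] -/
theorem norm_covDeriv_sandwich_cb_le (hl : l ≤ P.K) {cG cD cC δ : ℝ} (hcG : 0 ≤ cG) (hcD : 0 ≤ cD) (hcC : 0 ≤ cC)
    (hδ : 0 < δ)
    (hG : ∀ (g : ScalarField P 0 N) (M D : ℝ), (∀ x, ‖g x‖ ≤ M) → 0 ≤ D →
      ∀ x, (∀ z, g z ≠ 0 → D ≤ (HiggsLattice.Site.tdist x z : ℝ)) →
        ‖propagatorK C Finset.univ A msq a l g x‖ ≤ cG * Real.exp (-(δ * (D / (P.L : ℝ) ^ l))) * M)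
    (hDG : ∀ (g : ScalarField P 0 N) (M D : ℝ), (∀ x, ‖g x‖ ≤ M) → 0 ≤ D →
      ∀ b : HiggsLattice.PBond P 0, (∀ z, g z ≠ 0 → D ≤ (HiggsLattice.Site.tdist b.src z : ℝ)) →
        ‖covDeriv C A (propagatorK C Finset.univ A msq a l g) b‖ ≤ cD * Real.exp (-(δ * (D / (P.L : ℝ) ^ l))) * M)
    (hC : ∀ s t : HiggsLattice.Site P l × Ix N,
      |mat (fluctCovA C Finset.univ A msq a l) s t| ≤ cC * Real.exp (-(δ * (HiggsLattice.Site.tdist s.1 t.1 : ℝ))))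
    (q : HiggsLattice.Site P 0 × Ix N) (b : HiggsLattice.PBond P 0) :
    ‖covDeriv C A (sandwich C A msq a l (cb P N 0 q)) b‖
      ≤ (cD * Real.exp δ * Real.sqrt N) * (cG * Real.exp δ * Real.sqrt N) * cC * (((P.L : ℝ) ^ l) ^ P.d)⁻¹ *
          profile P N (δ / 2) ^ 2 * Real.exp (δ / 2) *
          Real.exp (-(δ / 2 * ((HiggsLattice.Site.tdist b.src q.1 : ℝ) / (P.L : ℝ) ^ l))) := by
  have h0 : sandwich C A msq a l (cb P N 0 q) = (propagatorK C Finset.univ A msq a l ∘ₗ avgQkAdj C A l)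
      (fluctCovA C Finset.univ A msq a l (avgQkLin C A l (propagatorK C Finset.univ A msq a l (cb P N 0 q)))) := by
    simp only [sandwich, LinearMap.comp_apply]
  rw [h0]
  refine (norm_covDeriv_apply_le_sum_coord C A _ _ b).trans ?_
  have hK : 0 ≤ profile P N (δ / 2) := profile_nonneg' _ (by linarith)
  calc ∑ s : HiggsLattice.Site P l × Ix N, |fieldCoord (E N) (HiggsLattice.Site P l)
            (fluctCovA C Finset.univ A msq a l (avgQkLin C A l (propagatorK C Finset.univ A msq a l (cb P N 0 q)))) s| *
          ‖covDeriv C A ((propagatorK C Finset.univ A msq a l ∘ₗ avgQkAdj C A l) (cb P N l s)) b‖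
      ≤ ∑ s : HiggsLattice.Site P l × Ix N,
          (∑ t : HiggsLattice.Site P l × Ix N, cC * Real.exp (-(δ * (HiggsLattice.Site.tdist s.1 t.1 : ℝ))) *
            ((((P.L : ℝ) ^ l) ^ P.d)⁻¹ *
              (cG * Real.exp δ * Real.exp (-(δ * (HiggsLattice.Site.tdist (blockIter l q.1) t.1 : ℝ))) * Real.sqrt N))) *
          (cD * Real.exp δ * Real.exp (-(δ * (HiggsLattice.Site.tdist (blockIter l b.src) s.1 : ℝ))) * Real.sqrt N) := by
        refine Finset.sum_le_sum fun s _ => ?_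
        have h1 : |fieldCoord (E N) (HiggsLattice.Site P l)
              (fluctCovA C Finset.univ A msq a l (avgQkLin C A l (propagatorK C Finset.univ A msq a l (cb P N 0 q)))) s|
            ≤ ∑ t : HiggsLattice.Site P l × Ix N, cC * Real.exp (-(δ * (HiggsLattice.Site.tdist s.1 t.1 : ℝ))) *
              ((((P.L : ℝ) ^ l) ^ P.d)⁻¹ *
                (cG * Real.exp δ * Real.exp (-(δ * (HiggsLattice.Site.tdist (blockIter l q.1) t.1 : ℝ))) * Real.sqrt N)) :=
          (abs_coord_CQG_le C A msq a s q).trans (Finset.sum_le_sum fun t _ =>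
            mul_le_mul (hC s t) (abs_mat_QG_le C A msq a hl hcG hδ.le hG t q) (abs_nonneg _) (by positivity))
        have h2 : ‖covDeriv C A ((propagatorK C Finset.univ A msq a l ∘ₗ avgQkAdj C A l) (cb P N l s)) b‖
            ≤ cD * Real.exp δ * Real.exp (-(δ * (HiggsLattice.Site.tdist (blockIter l b.src) s.1 : ℝ))) * Real.sqrt N := by
          rw [LinearMap.comp_apply]
          exact norm_covDeriv_G_avgQkAdj_cb_le C A msq a hl hcD hδ.le hDG s b
        exact mul_le_mul h1 h2 (norm_nonneg _) (Finset.sum_nonneg fun t _ => by positivity)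
    _ = (cD * Real.exp δ * Real.sqrt N) * (cG * Real.exp δ * Real.sqrt N) * cC * (((P.L : ℝ) ^ l) ^ P.d)⁻¹ *
          ∑ s : HiggsLattice.Site P l × Ix N, ∑ t : HiggsLattice.Site P l × Ix N,
            Real.exp (-(δ * (HiggsLattice.Site.tdist (blockIter l b.src) s.1 : ℝ))) *
              Real.exp (-(δ * (HiggsLattice.Site.tdist s.1 t.1 : ℝ))) *
              Real.exp (-(δ * (HiggsLattice.Site.tdist (blockIter l q.1) t.1 : ℝ))) := by
        rw [Finset.mul_sum]
        refine Finset.sum_congr rfl fun s _ => ?_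
        rw [Finset.sum_mul, Finset.mul_sum]
        refine Finset.sum_congr rfl fun t _ => ?_
        ring
    _ ≤ (cD * Real.exp δ * Real.sqrt N) * (cG * Real.exp δ * Real.sqrt N) * cC * (((P.L : ℝ) ^ l) ^ P.d)⁻¹ *
          (profile P N (δ / 2) ^ 2 *
            Real.exp (-(δ / 2 * (HiggsLattice.Site.tdist (blockIter l b.src) (blockIter l q.1) : ℝ)))) :=
        mul_le_mul_of_nonneg_left (sum3_le hδ (blockIter l b.src) (blockIter l q.1) q.2) (by positivity)
    _ ≤ (cD * Real.exp δ * Real.sqrt N) * (cG * Real.exp δ * Real.sqrt N) * cC * (((P.L : ℝ) ^ l) ^ P.d)⁻¹ *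
          (profile P N (δ / 2) ^ 2 * (Real.exp (δ / 2) *
            Real.exp (-(δ / 2 * ((HiggsLattice.Site.tdist b.src q.1 : ℝ) / (P.L : ℝ) ^ l))))) :=
        mul_le_mul_of_nonneg_left (mul_le_mul_of_nonneg_left (exp_blockIter_le hl hδ.le b.src q.1) (pow_nonneg hK 2))
          (by positivity)
    _ = _ := by ring

end Engine

/-! ## §4 The pieces in kernel form: `ε^{−d}Σ_{i′}‖(G^η_{(j)}e_{(x′,i′)})(x)‖` and its covariant derivative, bounded piece by piece -/

section PieceBounds

variable (C : ChargeData N) (A : HiggsLattice.VecField P 0) (msq : ℝ) {a : ℝ} {k j : ℕ}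

/-- `e_q` is supported at the site of `q`. [cite: Balaban1982Higgs1, (1.5) p.604] -/
theorem eq_of_cb_ne_zero {i : ℕ} (q : HiggsLattice.Site P i × Ix N) {y : HiggsLattice.Site P i} (h : cb P N i q y ≠ 0) :
    y = q.1 := by
  by_contra hne
  exact h (cb_apply_of_ne' q hne)

/-- The colour sum has `N` terms. [cite: Balaban1982Higgs1, (1.5) p.604] -/
theorem card_Ix : (Finset.univ : Finset (Ix N)).card = N := by
  rw [Finset.card_univ, Fintype.card_fin]
  exact nCol_eq N

/-- Rate weakening in a decay factor. [folklore] -/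
private theorem exp_rate_mono {ρ ρ' s : ℝ} (h : ρ' ≤ ρ) (hs : 0 ≤ s) : Real.exp (-(ρ * s)) ≤ Real.exp (-(ρ' * s)) :=
  Real.exp_le_exp.mpr (by nlinarith)

/-- scaling bookkeeping: `ε^{−d}·L^{−jd} = (L^jε)^{−d}`. [cite: Balaban1982Higgs1, (1.19) p.607] -/
private theorem inv_mesh_zero_pow_mul (j : ℕ) :
    (P.mesh 0 ^ P.d)⁻¹ * (((P.L : ℝ) ^ j) ^ P.d)⁻¹ = (P.mesh j ^ P.d)⁻¹ := by
  rw [mesh_eq_pow_mul P j, mul_pow, mul_inv, mul_comm]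

/-- scaling bookkeeping: `(L^jε)^{−n}(L^jε)^{n+m} = (L^jε)^m`. [cite: Balaban1982Higgs1, (1.19) p.607] -/
private theorem mesh_pow_cancel (j n m : ℕ) : (P.mesh j ^ n)⁻¹ * P.mesh j ^ (n + m) = P.mesh j ^ m := by
  rw [pow_add, inv_mul_cancel_left₀ (pow_ne_zero _ (P.mesh_pos j).ne')]

/-- **Piece `j = 0` (value)**: `ε^{−d}Σ_{i′}‖(G^ε_1e_{(x′,i′)})(x)‖ ≤ N√N·c₀L²·ε^{2}ε^{−d}·e^{−ρ|x − x′|/L}` from the (I.2.25) value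
clause at level `1` (`G^η_{(0)} = G^ε_1 = C^{(0)}`, source `e_{(x′,i′)}`: sup `≤ √N`, support `{x′}`).
[cite: Balaban1983Higgs3, (2.6) p.424, (2.10) p.426] [cite: Balaban1982Higgs1, Prop. 2.1 (2.25) p.610] -/
theorem absG_piece_zero_le {c₀ ρ : ℝ}
    (hG : ∀ (g : ScalarField P 0 N) (M D : ℝ), (∀ x, ‖g x‖ ≤ M) → 0 ≤ D →
      ∀ x, (∀ z, g z ≠ 0 → D ≤ (HiggsLattice.Site.tdist x z : ℝ)) →
        ‖propagatorK C Finset.univ A msq a 1 g x‖ ≤ c₀ * P.mesh 1 ^ 2 * Real.exp (-(ρ * (D / (P.L : ℝ) ^ 1))) * M)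
    (x x' : HiggsLattice.Site P 0) :
    (P.mesh 0 ^ P.d)⁻¹ * ∑ i' : Ix N, ‖pieceA C A msq a k 0 (cb P N 0 (x', i')) x‖
      ≤ ((N : ℝ) * Real.sqrt N * c₀ * (P.L : ℝ) ^ 2) * (P.mesh 0 ^ 2 * (P.mesh 0 ^ P.d)⁻¹) *
          Real.exp (-(ρ * ((HiggsLattice.Site.tdist x x' : ℝ) / (P.L : ℝ) ^ 1))) := by
  have h1 : ∀ i' : Ix N, ‖pieceA C A msq a k 0 (cb P N 0 (x', i')) x‖
      ≤ c₀ * P.mesh 1 ^ 2 * Real.exp (-(ρ * ((HiggsLattice.Site.tdist x x' : ℝ) / (P.L : ℝ) ^ 1))) * Real.sqrt N := by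
    intro i'
    rw [pieceA_zero]
    exact hG (cb P N 0 (x', i')) (Real.sqrt N) (HiggsLattice.Site.tdist x x') (norm_cb_le _) (Nat.cast_nonneg _) x
      (fun z hz => by rw [eq_of_cb_ne_zero _ hz])
  have hsum : ∑ i' : Ix N, ‖pieceA C A msq a k 0 (cb P N 0 (x', i')) x‖
      ≤ N * (c₀ * P.mesh 1 ^ 2 * Real.exp (-(ρ * ((HiggsLattice.Site.tdist x x' : ℝ) / (P.L : ℝ) ^ 1))) * Real.sqrt N) := by
    refine (Finset.sum_le_sum fun i' _ => h1 i').trans ?_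
    rw [Finset.sum_const, card_Ix, nsmul_eq_mul]
  refine (mul_le_mul_of_nonneg_left hsum (inv_nonneg.mpr (pow_nonneg (P.mesh_pos 0).le _))).trans (le_of_eq ?_)
  rw [mesh_eq_pow_mul P 1, pow_one]
  ring

/-- **Piece `j = 0` (covariant derivative)**: `ε^{−d}Σ_{i′}‖(D^ε_AG^ε_1e_{(x′,i′)})(⟨x,μ⟩)‖ ≤ N√N·c₀′L·ε·ε^{−d}·e^{−ρ|x − x′|/L}` from
the (I.2.25) derivative clause at level `1`. [cite: Balaban1983Higgs3, (2.6) p.424, (2.10) p.426]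
[cite: Balaban1982Higgs1, Prop. 2.1 (2.25) p.610] -/
theorem absDG_piece_zero_le {c₀' ρ : ℝ}
    (hDG : ∀ (g : ScalarField P 0 N) (M D : ℝ), (∀ x, ‖g x‖ ≤ M) → 0 ≤ D →
      ∀ b : HiggsLattice.PBond P 0, (∀ z, g z ≠ 0 → D ≤ (HiggsLattice.Site.tdist b.src z : ℝ)) →
        ‖covDeriv C A (propagatorK C Finset.univ A msq a 1 g) b‖
          ≤ c₀' * P.mesh 1 * Real.exp (-(ρ * (D / (P.L : ℝ) ^ 1))) * M)
    (μ : Fin P.d) (x x' : HiggsLattice.Site P 0) :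
    (P.mesh 0 ^ P.d)⁻¹ * ∑ i' : Ix N, ‖covDeriv C A (pieceA C A msq a k 0 (cb P N 0 (x', i'))) ⟨x, μ⟩‖
      ≤ ((N : ℝ) * Real.sqrt N * c₀' * (P.L : ℝ)) * (P.mesh 0 * (P.mesh 0 ^ P.d)⁻¹) *
          Real.exp (-(ρ * ((HiggsLattice.Site.tdist x x' : ℝ) / (P.L : ℝ) ^ 1))) := by
  have h1 : ∀ i' : Ix N, ‖covDeriv C A (pieceA C A msq a k 0 (cb P N 0 (x', i'))) ⟨x, μ⟩‖
      ≤ c₀' * P.mesh 1 * Real.exp (-(ρ * ((HiggsLattice.Site.tdist x x' : ℝ) / (P.L : ℝ) ^ 1))) * Real.sqrt N := by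
    intro i'
    rw [pieceA_zero]
    exact hDG (cb P N 0 (x', i')) (Real.sqrt N) (HiggsLattice.Site.tdist x x') (norm_cb_le _) (Nat.cast_nonneg _) ⟨x, μ⟩
      (fun z hz => by rw [eq_of_cb_ne_zero _ hz])
  have hsum : ∑ i' : Ix N, ‖covDeriv C A (pieceA C A msq a k 0 (cb P N 0 (x', i'))) ⟨x, μ⟩‖
      ≤ N * (c₀' * P.mesh 1 * Real.exp (-(ρ * ((HiggsLattice.Site.tdist x x' : ℝ) / (P.L : ℝ) ^ 1))) * Real.sqrt N) := by
    refine (Finset.sum_le_sum fun i' _ => h1 i').trans ?_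
    rw [Finset.sum_const, card_Ix, nsmul_eq_mul]
  refine (mul_le_mul_of_nonneg_left hsum (inv_nonneg.mpr (pow_nonneg (P.mesh_pos 0).le _))).trans (le_of_eq ?_)
  rw [mesh_eq_pow_mul P 1, pow_one]
  ring

/-- `a_j² ≤ a²` for the coefficients (I.2.22). [cite: Balaban1982Higgs1, (2.22) p.610] -/
theorem aSeq_sq_le (ha : 0 < a) (hL1 : 1 < P.L) (hj1 : 1 ≤ j) : B1.aSeq a (P.L : ℝ) j ^ 2 ≤ a ^ 2 := by
  have hL1' : 1 < (P.L : ℝ) := by exact_mod_cast hL1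
  exact pow_le_pow_left₀ (B1.aSeq_pos ha hL1' hj1).le (B1.aSeq_le ha hL1' j hj1) 2

/-- **Piece `1 ≤ j < k` (value)**: `ε^{−d}Σ_{i′}‖(G^η_{(j)}e_{(x′,i′)})(x)‖ ≤ N²a²c₀²c₁·e^{2δ}e^{δ/2}K(δ/2)² · (L^jε)²(L^jε)^{−d} ·
e^{−(δ/2)|x − x′|/L^j}` — the scaling `ε^{−d}·a_j²(L^jε)^{−4}·(L^jε)^{2+2+2}·L^{−jd} = a_j²(L^jε)^{2−d}` of the print's «rescaling
from the η-lattice to the L^{−j}-lattice». [cite: Balaban1983Higgs3, (2.6) p.424, (2.10) p.426]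
[cite: Balaban1982Higgs1, (2.43) p.612] -/
theorem absG_piece_pos_le (ha : 0 < a) (hL1 : 1 < P.L) (hj1 : 1 ≤ j) (hjk : j < k) (hjK : j ≤ P.K)
    {c₀ c₁ δ : ℝ} (hc₀ : 0 ≤ c₀) (hc₁ : 0 ≤ c₁) (hδ : 0 < δ)
    (hG : ∀ (g : ScalarField P 0 N) (M D : ℝ), (∀ x, ‖g x‖ ≤ M) → 0 ≤ D →
      ∀ x, (∀ z, g z ≠ 0 → D ≤ (HiggsLattice.Site.tdist x z : ℝ)) →
        ‖propagatorK C Finset.univ A msq a j g x‖ ≤ c₀ * P.mesh j ^ 2 * Real.exp (-(δ * (D / (P.L : ℝ) ^ j))) * M)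
    (hC : ∀ s t : HiggsLattice.Site P j × Ix N,
      |mat (fluctCovA C Finset.univ A msq a j) s t| ≤ c₁ * P.mesh j ^ 2 * Real.exp (-(δ * (HiggsLattice.Site.tdist s.1 t.1 : ℝ))))
    (x x' : HiggsLattice.Site P 0) :
    (P.mesh 0 ^ P.d)⁻¹ * ∑ i' : Ix N, ‖pieceA C A msq a k j (cb P N 0 (x', i')) x‖
      ≤ ((N : ℝ) ^ 2 * a ^ 2 * c₀ ^ 2 * c₁ * (Real.exp δ ^ 2 * Real.exp (δ / 2) * profile P N (δ / 2) ^ 2)) *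
        (P.mesh j ^ 2 * (P.mesh j ^ P.d)⁻¹) *
          Real.exp (-(δ / 2 * ((HiggsLattice.Site.tdist x x' : ℝ) / (P.L : ℝ) ^ j))) := by
  set X := Real.exp (-(δ / 2 * ((HiggsLattice.Site.tdist x x' : ℝ) / (P.L : ℝ) ^ j))) with hX
  have hm0 : 0 < P.mesh 0 := P.mesh_pos 0
  have hmj : 0 < P.mesh j := P.mesh_pos j
  have hLj : (0 : ℝ) < (P.L : ℝ) ^ j := pow_pos (by exact_mod_cast P.hL) j
  have hsw : ∀ i' : Ix N, ‖pieceA C A msq a k j (cb P N 0 (x', i')) x‖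
      ≤ coeff221 P a j ^ 2 * ((c₀ * P.mesh j ^ 2 * Real.exp δ * Real.sqrt N) ^ 2 * (c₁ * P.mesh j ^ 2) *
          (((P.L : ℝ) ^ j) ^ P.d)⁻¹ * profile P N (δ / 2) ^ 2 * Real.exp (δ / 2) * X) := by
    intro i'
    rw [pieceA_of_pos hj1 hjk, termA, LinearMap.smul_apply, Pi.smul_apply, norm_smul, Real.norm_eq_abs,
      abs_of_nonneg (sq_nonneg _)]
    exact mul_le_mul_of_nonneg_left
      (norm_sandwich_cb_le C A msq a hjK (by positivity) (by positivity) hδ hG hC (x', i') x) (sq_nonneg _)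
  have hsum : ∑ i' : Ix N, ‖pieceA C A msq a k j (cb P N 0 (x', i')) x‖
      ≤ N * (coeff221 P a j ^ 2 * ((c₀ * P.mesh j ^ 2 * Real.exp δ * Real.sqrt N) ^ 2 * (c₁ * P.mesh j ^ 2) *
          (((P.L : ℝ) ^ j) ^ P.d)⁻¹ * profile P N (δ / 2) ^ 2 * Real.exp (δ / 2) * X)) := by
    refine (Finset.sum_le_sum fun i' _ => hsw i').trans ?_
    rw [Finset.sum_const, card_Ix, nsmul_eq_mul]
  refine (mul_le_mul_of_nonneg_left hsum (inv_nonneg.mpr (pow_nonneg hm0.le _))).trans ?_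
  have hsq : (c₀ * P.mesh j ^ 2 * Real.exp δ * Real.sqrt N) ^ 2 = (c₀ * P.mesh j ^ 2 * Real.exp δ) ^ 2 * N := by
    rw [mul_pow (c₀ * P.mesh j ^ 2 * Real.exp δ), Real.sq_sqrt (Nat.cast_nonneg _)]
  -- the scaling identity
  have hid : (P.mesh 0 ^ P.d)⁻¹ * (N * (B1.aSeq a (P.L : ℝ) j ^ 2 * (P.mesh j ^ 4)⁻¹ *
        ((c₀ * P.mesh j ^ 2 * Real.exp δ) ^ 2 * N * (c₁ * P.mesh j ^ 2) *
          (((P.L : ℝ) ^ j) ^ P.d)⁻¹ * profile P N (δ / 2) ^ 2 * Real.exp (δ / 2) * X)))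
      = B1.aSeq a (P.L : ℝ) j ^ 2 * (((N : ℝ) ^ 2 * c₀ ^ 2 * c₁ *
          (Real.exp δ ^ 2 * Real.exp (δ / 2) * profile P N (δ / 2) ^ 2)) * (P.mesh j ^ 2 * (P.mesh j ^ P.d)⁻¹) * X) := by
    calc (P.mesh 0 ^ P.d)⁻¹ * (N * (B1.aSeq a (P.L : ℝ) j ^ 2 * (P.mesh j ^ 4)⁻¹ *
          ((c₀ * P.mesh j ^ 2 * Real.exp δ) ^ 2 * N * (c₁ * P.mesh j ^ 2) *
            (((P.L : ℝ) ^ j) ^ P.d)⁻¹ * profile P N (δ / 2) ^ 2 * Real.exp (δ / 2) * X)))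
        = B1.aSeq a (P.L : ℝ) j ^ 2 * (((N : ℝ) ^ 2 * c₀ ^ 2 * c₁ *
            (Real.exp δ ^ 2 * Real.exp (δ / 2) * profile P N (δ / 2) ^ 2)) * X) *
            ((P.mesh 0 ^ P.d)⁻¹ * (((P.L : ℝ) ^ j) ^ P.d)⁻¹) * ((P.mesh j ^ 4)⁻¹ * P.mesh j ^ (4 + 2)) := by ring
      _ = _ := by rw [inv_mesh_zero_pow_mul, mesh_pow_cancel]; ring
  rw [hsq, B1Eq243HiggsModel.coeff221_sq, hid]
  have hrest : 0 ≤ ((N : ℝ) ^ 2 * c₀ ^ 2 * c₁ * (Real.exp δ ^ 2 * Real.exp (δ / 2) * profile P N (δ / 2) ^ 2)) *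
      (P.mesh j ^ 2 * (P.mesh j ^ P.d)⁻¹) * X := by positivity
  calc B1.aSeq a (P.L : ℝ) j ^ 2 * (((N : ℝ) ^ 2 * c₀ ^ 2 * c₁ *
          (Real.exp δ ^ 2 * Real.exp (δ / 2) * profile P N (δ / 2) ^ 2)) * (P.mesh j ^ 2 * (P.mesh j ^ P.d)⁻¹) * X)
      ≤ a ^ 2 * (((N : ℝ) ^ 2 * c₀ ^ 2 * c₁ *
          (Real.exp δ ^ 2 * Real.exp (δ / 2) * profile P N (δ / 2) ^ 2)) * (P.mesh j ^ 2 * (P.mesh j ^ P.d)⁻¹) * X) :=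
        mul_le_mul_of_nonneg_right (aSeq_sq_le ha hL1 hj1) hrest
    _ = _ := by ring

/-- **Piece `1 ≤ j < k` (covariant derivative)**: the same with the (I.2.25) derivative clause on the first factor, one power of
`L^jε` less. [cite: Balaban1983Higgs3, (2.6) p.424, (2.10) p.426] [cite: Balaban1982Higgs1, (2.43) p.612] -/
theorem absDG_piece_pos_le (ha : 0 < a) (hL1 : 1 < P.L) (hj1 : 1 ≤ j) (hjk : j < k) (hjK : j ≤ P.K)
    {c₀ c₀' c₁ δ : ℝ} (hc₀ : 0 ≤ c₀) (hc₀' : 0 ≤ c₀') (hc₁ : 0 ≤ c₁) (hδ : 0 < δ)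
    (hG : ∀ (g : ScalarField P 0 N) (M D : ℝ), (∀ x, ‖g x‖ ≤ M) → 0 ≤ D →
      ∀ x, (∀ z, g z ≠ 0 → D ≤ (HiggsLattice.Site.tdist x z : ℝ)) →
        ‖propagatorK C Finset.univ A msq a j g x‖ ≤ c₀ * P.mesh j ^ 2 * Real.exp (-(δ * (D / (P.L : ℝ) ^ j))) * M)
    (hDG : ∀ (g : ScalarField P 0 N) (M D : ℝ), (∀ x, ‖g x‖ ≤ M) → 0 ≤ D →
      ∀ b : HiggsLattice.PBond P 0, (∀ z, g z ≠ 0 → D ≤ (HiggsLattice.Site.tdist b.src z : ℝ)) →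
        ‖covDeriv C A (propagatorK C Finset.univ A msq a j g) b‖
          ≤ c₀' * P.mesh j * Real.exp (-(δ * (D / (P.L : ℝ) ^ j))) * M)
    (hC : ∀ s t : HiggsLattice.Site P j × Ix N,
      |mat (fluctCovA C Finset.univ A msq a j) s t| ≤ c₁ * P.mesh j ^ 2 * Real.exp (-(δ * (HiggsLattice.Site.tdist s.1 t.1 : ℝ))))
    (μ : Fin P.d) (x x' : HiggsLattice.Site P 0) :
    (P.mesh 0 ^ P.d)⁻¹ * ∑ i' : Ix N, ‖covDeriv C A (pieceA C A msq a k j (cb P N 0 (x', i'))) ⟨x, μ⟩‖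
      ≤ ((N : ℝ) ^ 2 * a ^ 2 * (c₀' * c₀) * c₁ * (Real.exp δ ^ 2 * Real.exp (δ / 2) * profile P N (δ / 2) ^ 2)) *
        (P.mesh j * (P.mesh j ^ P.d)⁻¹) *
          Real.exp (-(δ / 2 * ((HiggsLattice.Site.tdist x x' : ℝ) / (P.L : ℝ) ^ j))) := by
  set X := Real.exp (-(δ / 2 * ((HiggsLattice.Site.tdist x x' : ℝ) / (P.L : ℝ) ^ j))) with hX
  have hm0 : 0 < P.mesh 0 := P.mesh_pos 0
  have hmj : 0 < P.mesh j := P.mesh_pos j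
  have hLj : (0 : ℝ) < (P.L : ℝ) ^ j := pow_pos (by exact_mod_cast P.hL) j
  have hsw : ∀ i' : Ix N, ‖covDeriv C A (pieceA C A msq a k j (cb P N 0 (x', i'))) ⟨x, μ⟩‖
      ≤ coeff221 P a j ^ 2 * ((c₀' * P.mesh j * Real.exp δ * Real.sqrt N) * (c₀ * P.mesh j ^ 2 * Real.exp δ * Real.sqrt N) *
          (c₁ * P.mesh j ^ 2) * (((P.L : ℝ) ^ j) ^ P.d)⁻¹ * profile P N (δ / 2) ^ 2 * Real.exp (δ / 2) * X) := by
    intro i'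
    rw [pieceA_of_pos hj1 hjk, termA, LinearMap.smul_apply, covDeriv_smul'', norm_smul, Real.norm_eq_abs,
      abs_of_nonneg (sq_nonneg _)]
    exact mul_le_mul_of_nonneg_left
      (norm_covDeriv_sandwich_cb_le C A msq a hjK (by positivity) (by positivity) (by positivity) hδ hG hDG hC (x', i') ⟨x, μ⟩)
      (sq_nonneg _)
  have hsum : ∑ i' : Ix N, ‖covDeriv C A (pieceA C A msq a k j (cb P N 0 (x', i'))) ⟨x, μ⟩‖
      ≤ N * (coeff221 P a j ^ 2 * ((c₀' * P.mesh j * Real.exp δ * Real.sqrt N) *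
          (c₀ * P.mesh j ^ 2 * Real.exp δ * Real.sqrt N) *
          (c₁ * P.mesh j ^ 2) * (((P.L : ℝ) ^ j) ^ P.d)⁻¹ * profile P N (δ / 2) ^ 2 * Real.exp (δ / 2) * X)) := by
    refine (Finset.sum_le_sum fun i' _ => hsw i').trans ?_
    rw [Finset.sum_const, card_Ix, nsmul_eq_mul]
  refine (mul_le_mul_of_nonneg_left hsum (inv_nonneg.mpr (pow_nonneg hm0.le _))).trans ?_
  rw [B1Eq243HiggsModel.coeff221_sq]
  have hre : (c₀' * P.mesh j * Real.exp δ * Real.sqrt N) * (c₀ * P.mesh j ^ 2 * Real.exp δ * Real.sqrt N)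
      = c₀' * c₀ * P.mesh j ^ 3 * Real.exp δ ^ 2 * N := by
    have h := Real.mul_self_sqrt (Nat.cast_nonneg N : (0 : ℝ) ≤ N)
    calc (c₀' * P.mesh j * Real.exp δ * Real.sqrt N) * (c₀ * P.mesh j ^ 2 * Real.exp δ * Real.sqrt N)
        = c₀' * c₀ * P.mesh j ^ 3 * Real.exp δ ^ 2 * (Real.sqrt N * Real.sqrt N) := by ring
      _ = _ := by rw [h]
  rw [hre]
  have hid : (P.mesh 0 ^ P.d)⁻¹ * (N * (B1.aSeq a (P.L : ℝ) j ^ 2 * (P.mesh j ^ 4)⁻¹ *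
        (c₀' * c₀ * P.mesh j ^ 3 * Real.exp δ ^ 2 * N * (c₁ * P.mesh j ^ 2) *
          (((P.L : ℝ) ^ j) ^ P.d)⁻¹ * profile P N (δ / 2) ^ 2 * Real.exp (δ / 2) * X)))
      = B1.aSeq a (P.L : ℝ) j ^ 2 * (((N : ℝ) ^ 2 * (c₀' * c₀) * c₁ *
          (Real.exp δ ^ 2 * Real.exp (δ / 2) * profile P N (δ / 2) ^ 2)) * (P.mesh j * (P.mesh j ^ P.d)⁻¹) * X) := by
    calc (P.mesh 0 ^ P.d)⁻¹ * (N * (B1.aSeq a (P.L : ℝ) j ^ 2 * (P.mesh j ^ 4)⁻¹ *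
          (c₀' * c₀ * P.mesh j ^ 3 * Real.exp δ ^ 2 * N * (c₁ * P.mesh j ^ 2) *
            (((P.L : ℝ) ^ j) ^ P.d)⁻¹ * profile P N (δ / 2) ^ 2 * Real.exp (δ / 2) * X)))
        = B1.aSeq a (P.L : ℝ) j ^ 2 * (((N : ℝ) ^ 2 * (c₀' * c₀) * c₁ *
            (Real.exp δ ^ 2 * Real.exp (δ / 2) * profile P N (δ / 2) ^ 2)) * X) *
            ((P.mesh 0 ^ P.d)⁻¹ * (((P.L : ℝ) ^ j) ^ P.d)⁻¹) * ((P.mesh j ^ 4)⁻¹ * P.mesh j ^ (4 + 1)) := by ring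
      _ = _ := by rw [inv_mesh_zero_pow_mul, mesh_pow_cancel, pow_one]; ring
  rw [hid]
  have hrest : 0 ≤ ((N : ℝ) ^ 2 * (c₀' * c₀) * c₁ * (Real.exp δ ^ 2 * Real.exp (δ / 2) * profile P N (δ / 2) ^ 2)) *
      (P.mesh j * (P.mesh j ^ P.d)⁻¹) * X := by positivity
  calc B1.aSeq a (P.L : ℝ) j ^ 2 * (((N : ℝ) ^ 2 * (c₀' * c₀) * c₁ *
          (Real.exp δ ^ 2 * Real.exp (δ / 2) * profile P N (δ / 2) ^ 2)) * (P.mesh j * (P.mesh j ^ P.d)⁻¹) * X)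
      ≤ a ^ 2 * (((N : ℝ) ^ 2 * (c₀' * c₀) * c₁ *
          (Real.exp δ ^ 2 * Real.exp (δ / 2) * profile P N (δ / 2) ^ 2)) * (P.mesh j * (P.mesh j ^ P.d)⁻¹) * X) :=
        mul_le_mul_of_nonneg_right (aSeq_sq_le ha hL1 hj1) hrest
    _ = _ := by ring

/-- **Pieces `j ≥ k`, `j ≥ 1` vanish** (no such terms in (2.6)). [cite: Balaban1983Higgs3, (2.6) p.424] -/
theorem absG_piece_ge_eq_zero (hj1 : 1 ≤ j) (hkj : k ≤ j) (x x' : HiggsLattice.Site P 0) :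
    (P.mesh 0 ^ P.d)⁻¹ * ∑ i' : Ix N, ‖pieceA C A msq a k j (cb P N 0 (x', i')) x‖ = 0 := by
  simp [pieceA_of_le hj1 hkj]

/-- **Pieces `j ≥ k`, `j ≥ 1` vanish**, derivative. [cite: Balaban1983Higgs3, (2.6) p.424] -/
theorem absDG_piece_ge_eq_zero (hj1 : 1 ≤ j) (hkj : k ≤ j) (μ : Fin P.d) (x x' : HiggsLattice.Site P 0) :
    (P.mesh 0 ^ P.d)⁻¹ * ∑ i' : Ix N, ‖covDeriv C A (pieceA C A msq a k j (cb P N 0 (x', i'))) ⟨x, μ⟩‖ = 0 := by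
  simp [pieceA_of_le hj1 hkj, covDeriv_zero'']

/-- **The regularity hypothesis of (I.2.25) in p35's (2.23)-form, from `δ_A`-regularity and the smallness `L^kδ_A|e| ≤ T ≤ e₁`**
(at every level `l ≤ k` with `L^lε ≤ 1`; `β = 1`, `c_reg = 1`, `e_c = e₁`). [cite: Balaban1982Higgs1, (2.23) p.610] -/
theorem reg223_of_small {l : ℕ} (hlk : l ≤ k) (hmesh : P.mesh l ≤ 1) {ec δA T : ℝ} (hec : 0 < ec) (hδA : 0 ≤ δA)
    (hreg : ∀ (z : HiggsLattice.Site P 0) (μ ν : Fin P.d), |A ⟨z.shift ν, μ⟩ - A ⟨z, μ⟩| ≤ δA)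
    (ht : (P.L : ℝ) ^ k * δA * |C.e| ≤ T) (hT : T ≤ ec) :
    ∀ (x : HiggsLattice.Site P 0) (μ ν : Fin P.d),
      P.mesh l * |C.e| / ec * |A ⟨x.shift μ, ν⟩ - A ⟨x, ν⟩| ≤ 1 * ec ^ ((1 : ℝ) - 1) / (P.L : ℝ) ^ l := by
  intro x μ ν
  have hLl : (0 : ℝ) < (P.L : ℝ) ^ l := pow_pos (by exact_mod_cast P.hL) l
  have hL1 : (1 : ℝ) ≤ P.L := by exact_mod_cast P.hL
  have hA := hreg x ν μ
  have he : 0 ≤ |C.e| := abs_nonneg _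
  have hpow : (P.L : ℝ) ^ l ≤ (P.L : ℝ) ^ k := pow_le_pow_right₀ hL1 hlk
  rw [sub_self, Real.rpow_zero, one_mul, div_mul_eq_mul_div, div_le_div_iff₀ hec hLl, one_mul]
  have h₂ : P.mesh l * |C.e| ≤ 1 * |C.e| := mul_le_mul_of_nonneg_right hmesh he
  have h₁ : P.mesh l * |C.e| * |A ⟨x.shift μ, ν⟩ - A ⟨x, ν⟩| ≤ 1 * |C.e| * δA :=
    mul_le_mul h₂ hA (abs_nonneg _) (by positivity)
  calc P.mesh l * |C.e| * |A ⟨x.shift μ, ν⟩ - A ⟨x, ν⟩| * (P.L : ℝ) ^ l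
      ≤ 1 * |C.e| * δA * (P.L : ℝ) ^ k := mul_le_mul h₁ hpow hLl.le (by positivity)
    _ = (P.L : ℝ) ^ k * δA * |C.e| := by ring
    _ ≤ ec := ht.trans hT

end PieceBounds

/-! ## §5 The concrete carrier of B3 (2.10) at a regular non-constant background on the torus, and (2.10) PROVED for it -/

open B1Eq211ZeroFieldTorus (Shape)

/-- **The concrete carrier of B3 (2.5)/(2.10)–(2.12) for `Ω = T_η` (the whole torus) at a REGULAR NON-CONSTANT background
`B̃ = A`** (a `u(N)`-valued configuration on the bonds of `T_ε`, charge data `C`), at the scale `k` of the volume `P` of Bałaban's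
(Higgs)₂,₃ torus family (`S : Shape P`: `L` odd `> 1`, equal periods): sites `x ∈ T_ε = Site P 0` (`η = ε = L^{−K}`-lattice in
ε-units: `η := L^0ε`), `dist x x′ = ε·|x − x′|` (sup torus distance (I.1.3)), `L`, `d`; `absG j x x′ = ε^{−d}Σ_{i′}‖(G^η_{(j)}e_{(x′,i′)})(x)‖`
— the column-sum norm of the `N × N` block `G^η_{(j)}(Ω, B̃; x, x′)` of the kernel of the piece (2.6) w.r.t. the `ε^d`-weighted
product (I.1.5) (`pieceA`: `G^η_{(0)} = G^ε_1(T_ε,A)`, `G^η_{(j)} = a_j²(L^jε)^{−4}G^ε_jQ_j^*C^{(j)}Q_jG^ε_j(T_ε,A)` for `1 ≤ j < k`);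
`absDG j μ x x′ = ε^{−d}Σ_{i′}‖(D^ε_{A,μ}G^η_{(j)}e_{(x′,i′)})(x)‖` (covariant derivative (I.1.7) in the row variable); the
fields of (2.5), (2.11), (2.12) are NOT modelled (set to `0`; nothing is claimed about them).  By (2.6) (`sum_pieceA`)
`Σ_{j<k} G^η_{(j)} = G^ε_k(T_ε, A)`. [cite: Balaban1983Higgs3, (2.6) p.424, (2.10) p.426] -/
def regTorusKernels (S : Shape P) (C : ChargeData N) (A : HiggsLattice.VecField P 0) (msq a : ℝ) (k : ℕ) :
    ScaledKernels where
  Site := HiggsLattice.Site P 0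
  Bond := HiggsLattice.PBond P 0
  Dir := Fin P.d
  LocFn := PUnit
  dist := fun x x' => P.mesh 0 * (HiggsLattice.Site.tdist x x' : ℝ)
  dist2 := fun _ _ _ => 0
  distBlock := fun _ _ _ => 0
  distSupp := fun _ _ => 0
  distΩ₂ := 0
  L := P.L
  η := P.mesh 0
  d := P.d
  eRun := 0
  pRun := 0
  one_lt_L := by exact_mod_cast S.hL.2
  η_pos := P.mesh_pos 0
  absG := fun j x x' => (P.mesh 0 ^ P.d)⁻¹ * ∑ i' : Ix N, ‖pieceA C A msq a k j (cb P N 0 (x', i')) x‖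
  absDG := fun j μ x x' => (P.mesh 0 ^ P.d)⁻¹ * ∑ i' : Ix N, ‖covDeriv C A (pieceA C A msq a k j (cb P N 0 (x', i'))) ⟨x, μ⟩‖
  holderDiff := fun _ _ _ _ _ => 0
  absGavg := fun _ _ _ => 0
  normDeltaG := fun _ _ _ => 0
  norm116 := fun _ _ _ _ _ => 0

section Carrier

variable {S : Shape P} {C : ChargeData N} {A : HiggsLattice.VecField P 0} {msq a : ℝ} {k : ℕ}

/-- the carrier's `L^jη` is the model's `L^jε`. [cite: Balaban1983Higgs3, (2.10) p.426] -/
theorem scale_eq (j : ℕ) : (regTorusKernels S C A msq a k).scale j = P.mesh j := by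
  show (P.L : ℝ) ^ j * P.mesh 0 = P.mesh j
  rw [mesh_eq_pow_mul P j]

/-- the carrier's `d`. [cite: Balaban1983Higgs3, (2.10) p.426] -/
theorem regTorusKernels_d : (regTorusKernels S C A msq a k).d = P.d := rfl

/-- the carrier's distance `ε|x − x′|`. [cite: Balaban1983Higgs3, (2.10) p.426] -/
theorem regTorusKernels_dist (x x' : HiggsLattice.Site P 0) :
    (regTorusKernels S C A msq a k).dist x x' = P.mesh 0 * (HiggsLattice.Site.tdist x x' : ℝ) := rfl

/-- the carrier's `|G^η_{(j)}(x, x′)|`. [cite: Balaban1983Higgs3, (2.10) p.426] -/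
theorem regTorusKernels_absG (j : ℕ) (x x' : HiggsLattice.Site P 0) :
    (regTorusKernels S C A msq a k).absG j x x'
      = (P.mesh 0 ^ P.d)⁻¹ * ∑ i' : Ix N, ‖pieceA C A msq a k j (cb P N 0 (x', i')) x‖ := rfl

/-- the carrier's `|(D^η_{B̃,μ}G^η_{(j)})(x, x′)|`. [cite: Balaban1983Higgs3, (2.10) p.426] -/
theorem regTorusKernels_absDG (j : ℕ) (μ : Fin P.d) (x x' : HiggsLattice.Site P 0) :
    (regTorusKernels S C A msq a k).absDG j μ x x'
      = (P.mesh 0 ^ P.d)⁻¹ * ∑ i' : Ix N, ‖covDeriv C A (pieceA C A msq a k j (cb P N 0 (x', i'))) ⟨x, μ⟩‖ := rfl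

/-- kernel: `(L^jη)^{2−d} = (L^jη)²·((L^jη)^d)^{−1}` (real exponent). [folklore] -/
private theorem rpow_two_sub (j : ℕ) : P.mesh j ^ ((2 : ℝ) - (P.d : ℝ)) = P.mesh j ^ 2 * (P.mesh j ^ P.d)⁻¹ := by
  rw [Real.rpow_sub (P.mesh_pos j), div_eq_mul_inv, Real.rpow_natCast _ P.d, Real.rpow_two]

/-- kernel: `(L^jη)^{1−d} = (L^jη)·((L^jη)^d)^{−1}`. [folklore] -/
private theorem rpow_one_sub (j : ℕ) : P.mesh j ^ ((1 : ℝ) - (P.d : ℝ)) = P.mesh j * (P.mesh j ^ P.d)⁻¹ := by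
  rw [Real.rpow_sub (P.mesh_pos j), div_eq_mul_inv, Real.rpow_natCast _ P.d, Real.rpow_one]

/-- kernel: `(L^jη)^{−1}·(ε|x − x′|) = |x − x′|/L^j`. [folklore] -/
private theorem scale_inv_mul_dist (j : ℕ) (x x' : HiggsLattice.Site P 0) :
    (P.mesh j)⁻¹ * (P.mesh 0 * (HiggsLattice.Site.tdist x x' : ℝ)) = (HiggsLattice.Site.tdist x x' : ℝ) / (P.L : ℝ) ^ j := by
  rw [mesh_eq_pow_mul P j, mul_inv, mul_assoc, ← mul_assoc (P.mesh 0)⁻¹, inv_mul_cancel₀ (P.mesh_pos 0).ne', one_mul,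
    div_eq_inv_mul]

/-- **Transfer**: kernel bounds in the model's units give `Ineq210` for the carrier. [cite: Balaban1983Higgs3, (2.10) p.426] -/
theorem ineq210_of_bounds {δ₁ Cst : ℝ}
    (hv : ∀ (j : ℕ) (x x' : HiggsLattice.Site P 0),
      (P.mesh 0 ^ P.d)⁻¹ * ∑ i' : Ix N, ‖pieceA C A msq a k j (cb P N 0 (x', i')) x‖
        ≤ Cst * (P.mesh j ^ 2 * (P.mesh j ^ P.d)⁻¹) *
          Real.exp (-(δ₁ * ((HiggsLattice.Site.tdist x x' : ℝ) / (P.L : ℝ) ^ j))))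
    (hd : ∀ (j : ℕ) (μ : Fin P.d) (x x' : HiggsLattice.Site P 0),
      (P.mesh 0 ^ P.d)⁻¹ * ∑ i' : Ix N, ‖covDeriv C A (pieceA C A msq a k j (cb P N 0 (x', i'))) ⟨x, μ⟩‖
        ≤ Cst * (P.mesh j * (P.mesh j ^ P.d)⁻¹) *
          Real.exp (-(δ₁ * ((HiggsLattice.Site.tdist x x' : ℝ) / (P.L : ℝ) ^ j)))) :
    (regTorusKernels S C A msq a k).Ineq210 δ₁ Cst := by
  intro j x x'
  rw [scale_eq, regTorusKernels_d, regTorusKernels_dist, regTorusKernels_absG, rpow_two_sub, rpow_one_sub,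
    mul_assoc δ₁, scale_inv_mul_dist]
  refine ⟨hv j x x', fun μ => ?_⟩
  rw [regTorusKernels_absDG]
  exact hd j μ x x'

end Carrier

/-- **The constant `O(1)` of (2.10)** assembled from the constants of (I.2.25) (`c₀` value, `c₀′` derivative) and of (I.2.34)
(`c₁`), the common decay rate `δ`, `N`, `a`, `L`, `d` (through the lattice-sum profile `K = N·K_d`).
[cite: Balaban1983Higgs3, (2.10) p.426] -/
def cst210 (d L N : ℕ) (a c₀ c₀' c₁ δ : ℝ) : ℝ :=
  1 + (N : ℝ) * Real.sqrt N * c₀ * (L : ℝ) ^ 2 + (N : ℝ) * Real.sqrt N * c₀' * (L : ℝ) +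
    (N : ℝ) ^ 2 * a ^ 2 * c₀ ^ 2 * c₁ *
      (Real.exp δ ^ 2 * Real.exp (δ / 2) * ((nCol N : ℝ) * B4Sect5Proof.latticeConst d (δ / 2)) ^ 2) +
    (N : ℝ) ^ 2 * a ^ 2 * (c₀' * c₀) * c₁ *
      (Real.exp δ ^ 2 * Real.exp (δ / 2) * ((nCol N : ℝ) * B4Sect5Proof.latticeConst d (δ / 2)) ^ 2)

section Constant

variable {d L N : ℕ} {a c₀ c₀' c₁ δ : ℝ}

/-- the four summands of `cst210` are nonnegative. [cite: Balaban1983Higgs3, (2.10) p.426] -/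
private theorem cst210_summands_nonneg (hc₀ : 0 ≤ c₀) (hc₀' : 0 ≤ c₀') (hc₁ : 0 ≤ c₁) :
    0 ≤ (N : ℝ) * Real.sqrt N * c₀ * (L : ℝ) ^ 2 ∧ 0 ≤ (N : ℝ) * Real.sqrt N * c₀' * (L : ℝ) ∧
    0 ≤ (N : ℝ) ^ 2 * a ^ 2 * c₀ ^ 2 * c₁ *
      (Real.exp δ ^ 2 * Real.exp (δ / 2) * ((nCol N : ℝ) * B4Sect5Proof.latticeConst d (δ / 2)) ^ 2) ∧
    0 ≤ (N : ℝ) ^ 2 * a ^ 2 * (c₀' * c₀) * c₁ *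
      (Real.exp δ ^ 2 * Real.exp (δ / 2) * ((nCol N : ℝ) * B4Sect5Proof.latticeConst d (δ / 2)) ^ 2) :=
  ⟨by positivity, by positivity, by positivity, by positivity⟩

/-- `cst210 > 0`. [cite: Balaban1983Higgs3, (2.10) p.426] -/
theorem cst210_pos (hc₀ : 0 ≤ c₀) (hc₀' : 0 ≤ c₀') (hc₁ : 0 ≤ c₁) : 0 < cst210 d L N a c₀ c₀' c₁ δ := by
  obtain ⟨h1, h2, h3, h4⟩ := cst210_summands_nonneg (d := d) (L := L) (N := N) (a := a) (δ := δ) hc₀ hc₀' hc₁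
  unfold cst210; linarith

/-- `N√N·c₀L² ≤ cst210`. [cite: Balaban1983Higgs3, (2.10) p.426] -/
theorem le_cst210_zero (hc₀ : 0 ≤ c₀) (hc₀' : 0 ≤ c₀') (hc₁ : 0 ≤ c₁) :
    (N : ℝ) * Real.sqrt N * c₀ * (L : ℝ) ^ 2 ≤ cst210 d L N a c₀ c₀' c₁ δ := by
  obtain ⟨h1, h2, h3, h4⟩ := cst210_summands_nonneg (d := d) (L := L) (N := N) (a := a) (δ := δ) hc₀ hc₀' hc₁
  unfold cst210; linarith

/-- `N√N·c₀′L ≤ cst210`. [cite: Balaban1983Higgs3, (2.10) p.426] -/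
theorem le_cst210_zero' (hc₀ : 0 ≤ c₀) (hc₀' : 0 ≤ c₀') (hc₁ : 0 ≤ c₁) :
    (N : ℝ) * Real.sqrt N * c₀' * (L : ℝ) ≤ cst210 d L N a c₀ c₀' c₁ δ := by
  obtain ⟨h1, h2, h3, h4⟩ := cst210_summands_nonneg (d := d) (L := L) (N := N) (a := a) (δ := δ) hc₀ hc₀' hc₁
  unfold cst210; linarith

/-- `N²a²c₀²c₁·e^{2δ}e^{δ/2}K(δ/2)² ≤ cst210`. [cite: Balaban1983Higgs3, (2.10) p.426] -/
theorem le_cst210_pos (hc₀ : 0 ≤ c₀) (hc₀' : 0 ≤ c₀') (hc₁ : 0 ≤ c₁) :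
    (N : ℝ) ^ 2 * a ^ 2 * c₀ ^ 2 * c₁ *
      (Real.exp δ ^ 2 * Real.exp (δ / 2) * ((nCol N : ℝ) * B4Sect5Proof.latticeConst d (δ / 2)) ^ 2)
      ≤ cst210 d L N a c₀ c₀' c₁ δ := by
  obtain ⟨h1, h2, h3, h4⟩ := cst210_summands_nonneg (d := d) (L := L) (N := N) (a := a) (δ := δ) hc₀ hc₀' hc₁
  unfold cst210; linarith

/-- `N²a²c₀′c₀c₁·e^{2δ}e^{δ/2}K(δ/2)² ≤ cst210`. [cite: Balaban1983Higgs3, (2.10) p.426] -/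
theorem le_cst210_pos' (hc₀ : 0 ≤ c₀) (hc₀' : 0 ≤ c₀') (hc₁ : 0 ≤ c₁) :
    (N : ℝ) ^ 2 * a ^ 2 * (c₀' * c₀) * c₁ *
      (Real.exp δ ^ 2 * Real.exp (δ / 2) * ((nCol N : ℝ) * B4Sect5Proof.latticeConst d (δ / 2)) ^ 2)
      ≤ cst210 d L N a c₀ c₀' c₁ δ := by
  obtain ⟨h1, h2, h3, h4⟩ := cst210_summands_nonneg (d := d) (L := L) (N := N) (a := a) (δ := δ) hc₀ hc₀' hc₁
  unfold cst210; linarith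

end Constant

/-! ## §6 (2.10) PROVED for the carrier: regular non-constant background, `Ω = T_η`, uniformly in the volume -/

section Main

/-- weakening in the exponent with a change of rate: `e^{−ρs} ≤ e^{−ρ′s′}` when `ρ′s′ ≤ ρs`. [folklore] -/
private theorem exp_le_exp_of_le {u v : ℝ} (h : v ≤ u) : Real.exp (-u) ≤ Real.exp (-v) :=
  Real.exp_le_exp.mpr (neg_le_neg h)

/-- **B3 (2.10) p. 426 [PDF 16] PROVED AT A REGULAR NON-CONSTANT BACKGROUND `B̃ = A` ON THE TORUS `Ω = T_η`, uniformly in the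
volume.**  For `d, L` (`L` odd `> 1`), `a > 0`, `m² > 0`, `N`, charge data `C = (e, U)` there are a threshold `K₀,min` and, for every
cube size `K₀`, constants `t(K₀), δ₁(K₀), C(K₀) > 0` such that: for every `K₀ ≥ K₀,min`, every volume `P` of the (Higgs)₂,₃ torus
family with these `d, L` (`S : Shape P`) tiled by `K₀`-cubes (`K₀ ∣ M`, `3K₀ ≤ 2M`), every scale `1 ≤ k ≤ K` with `L^kε ≤ 1`, and
every `δ_A`-REGULAR configuration `A` on `T_ε` — `|A(⟨z + e_ν, μ⟩) − A(⟨z, μ⟩)| ≤ δ_A` for all `z, μ, ν` (the (I.2.23)/(I.3.13)-type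
regularity: field strength `≤ δ_A/ε` in ε-units) — with the smallness `L^k·δ_A·|e| ≤ t(K₀)`:
`(regTorusKernels S C A msq a k).Ineq210 (δ₁ K₀) (C K₀)`, i.e. for all `j`, `x, x′ ∈ T_η`, `μ`,
`|G^η_{(j)}(T_η, A; x, x′)| ≤ C(L^jη)^{2−d}e^{−δ₁(L^jη)^{−1}|x−x′|}` and `|(D^η_{A,μ}G^η_{(j)})(T_η, A; x, x′)| ≤ C(L^jη)^{1−d}e^{−δ₁(L^jη)^{−1}|x−x′|}`.
Print: *"For the propagators G^η_{(j)} we apply the inequality |G^η_{(j)}(Ω, B̃; x, x′)| ≤ O(1)(L^jη)^{−d+2}e^{−δ₁(L^jη)^{−1}|x−x′|},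
(2.10) and if the propagator is differentiated, then for each differentiation, there is an additional factor (L^jη)^{−1} on the
right side. … They all are obtained by rescaling from the η-lattice to the L^{−j}-lattice and application of Propositions I.2.1
and I.2.3."*  Route: exactly that — the pieces (2.6) are the terms of (I.2.43) at `A` (`sum_pieceA`); each term
`a_j²(L^jε)^{−4}G^ε_jQ_j^*C^{(j)}Q_jG^ε_j` is bounded through Proposition I.2.1 (2.25) at a regular `A` on the torus
(`B1Ineq225RegularTorus.norm_propagatorK_reg_decay`, `norm_covDeriv_propagatorK_reg_decay` — value and covariant derivative of
`G^ε_j(T_ε, A)`), Proposition I.2.3 (2.34) at a regular `A` on the torus (`B1Props21to23RegularTorus.ineq234_236_regular_torus_std` —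
the kernel of `C^{(j)}(T_ε, A)`), the adjointness `(Q_jG^ε_j)^* = G^ε_jQ_j^*` for the products (I.1.5) (the factor `L^{−jd}`) and
the three-kernel convolution on `T^{(j)}` (`sum3_le`); the piece `G^η_{(0)} = G^ε_1 = C^{(0)}` is (2.25) at level `1`.
Honest scope: torus only (`Ω = T_η`, no region/boundary: (2.5), (2.11), (2.12) and general `Ω` are NOT addressed); `m² > 0`;
the `Shape` sub-family and the cube tiling of the cited torus theorems; constants depend on `K₀` (as in the cited inputs);
`absG` is the column-sum norm over the source colour of the `N × N` block kernel.
[cite: Balaban1983Higgs3, (2.6) p.424, (2.10) p.426] [cite: Balaban1982Higgs1, Prop. 2.1 (2.25) p.610, Prop. 2.3 (2.34) p.611, (2.43) p.612] -/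
theorem ineq210_regularTorus (d L : ℕ) (hL : Odd L ∧ 1 < L) {a : ℝ} (ha : 0 < a) {msq : ℝ} (hmsq : 0 < msq)
    (N : ℕ) (C : ChargeData N) :
    ∃ K₀min : ℕ, ∃ t δ₁ Cst : ℕ → ℝ, (∀ K₀, 0 < t K₀ ∧ 0 < δ₁ K₀ ∧ 0 < Cst K₀) ∧
      ∀ K₀ : ℕ, K₀min ≤ K₀ →
      ∀ (P : HiggsLattice.Params) (S : Shape P), P.d = d → P.L = L → K₀ ∣ P.M → 3 * K₀ ≤ 2 * P.M →
      ∀ {k : ℕ}, 1 ≤ k → k ≤ P.K → P.mesh k ≤ 1 →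
      ∀ (A : HiggsLattice.VecField P 0) {δA : ℝ}, 0 ≤ δA →
        (∀ (z : HiggsLattice.Site P 0) (μ ν : Fin P.d), |A ⟨z.shift ν, μ⟩ - A ⟨z, μ⟩| ≤ δA) →
        (P.L : ℝ) ^ k * δA * |C.e| ≤ t K₀ →
        (regTorusKernels S C A msq a k).Ineq210 (δ₁ K₀) (Cst K₀) := by
  have hL2 : 2 ≤ L := hL.2
  obtain ⟨c₀, hc₀, K₁, e₁, ρ₁, hpos₁, hV⟩ :=
    B1Ineq225RegularTorus.norm_propagatorK_reg_decay d L hL2 ha hmsq N C 1 1 1 zero_le_one one_pos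
  obtain ⟨c₀', hc₀', K₂, e₂, ρ₂, hpos₂, hD⟩ :=
    B1Ineq225RegularTorus.norm_covDeriv_propagatorK_reg_decay d L hL2 ha hmsq N C 1 1 1 zero_le_one one_pos
  obtain ⟨K₃, tA, c₁, ρ₃, hpos₃, hCov⟩ := B1Props21to23RegularTorus.ineq234_236_regular_torus_std d L hL ha hmsq N C
  -- the common decay rate of the three inputs
  obtain ⟨δ, hδ⟩ : ∃ δ : ℕ → ℝ, ∀ K₀, δ K₀ = min (ρ₁ K₀) (min (ρ₂ K₀) (ρ₃ K₀)) := ⟨_, fun _ => rfl⟩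
  have hδpos : ∀ K₀, 0 < δ K₀ := fun K₀ => by
    rw [hδ]; exact lt_min (hpos₁ K₀).2 (lt_min (hpos₂ K₀).2 (hpos₃ K₀).2.2)
  have hLpos : (0 : ℝ) < L := by exact_mod_cast (by omega : 0 < L)
  refine ⟨max K₁ (max K₂ K₃), fun K₀ => min (tA K₀) (min (e₁ K₀) (e₂ K₀)), fun K₀ => δ K₀ / (2 * L),
    fun K₀ => cst210 d L N a c₀ c₀' (c₁ K₀) (δ K₀), fun K₀ => ⟨?_, ?_, ?_⟩, ?_⟩
  · exact lt_min (hpos₃ K₀).1 (lt_min (hpos₁ K₀).1 (hpos₂ K₀).1)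
  · exact div_pos (hδpos K₀) (by positivity)
  · exact cst210_pos hc₀.le hc₀'.le (hpos₃ K₀).2.1.le
  intro K₀ hK₀ P S hPd hPL hK₀M h3M k hk1 hkK hmesh A δA hδA hreg ht
  have hK₁ : K₁ ≤ K₀ := (le_max_left _ _).trans hK₀
  have hK₂ : K₂ ≤ K₀ := ((le_max_left _ _).trans (le_max_right _ _)).trans hK₀
  have hK₃ : K₃ ≤ K₀ := ((le_max_right _ _).trans (le_max_right _ _)).trans hK₀
  subst hPd hPL
  have hL1 : 1 < P.L := hL.2
  have hLge1 : (1 : ℝ) ≤ P.L := by exact_mod_cast P.hL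
  have hc₁ : 0 ≤ c₁ K₀ := (hpos₃ K₀).2.1.le
  have hδK : 0 < δ K₀ := hδpos K₀
  have hδ₁ : δ K₀ ≤ ρ₁ K₀ := by rw [hδ]; exact min_le_left _ _
  have hδ₂ : δ K₀ ≤ ρ₂ K₀ := by rw [hδ]; exact (min_le_right _ _).trans (min_le_left _ _)
  have hδ₃ : δ K₀ ≤ ρ₃ K₀ := by rw [hδ]; exact (min_le_right _ _).trans (min_le_right _ _)
  have htA : (P.L : ℝ) ^ k * δA * |C.e| ≤ tA K₀ := ht.trans (min_le_left _ _)
  have hte₁ : (P.L : ℝ) ^ k * δA * |C.e| ≤ e₁ K₀ := ht.trans ((min_le_right _ _).trans (min_le_left _ _))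
  have hte₂ : (P.L : ℝ) ^ k * δA * |C.e| ≤ e₂ K₀ := ht.trans ((min_le_right _ _).trans (min_le_right _ _))
  have hCst : 0 ≤ cst210 P.d P.L N a c₀ c₀' (c₁ K₀) (δ K₀) := (cst210_pos hc₀.le hc₀'.le hc₁).le
  -- the three inputs at every level `1 ≤ l ≤ k`, in the engine's form with the common rate `δ K₀`
  have hGl : ∀ {l : ℕ}, 1 ≤ l → l ≤ k → ∀ (g : ScalarField P 0 N) (M D : ℝ), (∀ x, ‖g x‖ ≤ M) → 0 ≤ D →
      ∀ x, (∀ z, g z ≠ 0 → D ≤ (HiggsLattice.Site.tdist x z : ℝ)) →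
        ‖propagatorK C Finset.univ A msq a l g x‖ ≤ c₀ * P.mesh l ^ 2 * Real.exp (-(δ K₀ * (D / (P.L : ℝ) ^ l))) * M := by
    intro l hl1 hlk g M D hg hD0 x hsupp
    have hmesh_l : P.mesh l ≤ 1 := (mesh_mono P hlk).trans hmesh
    have h := hV K₀ hK₁ P rfl rfl hK₀M h3M hl1 (hlk.trans hkK) hmesh_l A (hpos₁ K₀).1 le_rfl
      (reg223_of_small C A hlk hmesh_l (hpos₁ K₀).1 hδA hreg hte₁ le_rfl) g M D hg hD0 x hsupp
    refine h.trans ?_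
    have hM : 0 ≤ M := (norm_nonneg _).trans (hg x)
    have hexp := exp_rate_mono hδ₁ (show (0 : ℝ) ≤ D / (P.L : ℝ) ^ l by positivity)
    exact mul_le_mul_of_nonneg_right (mul_le_mul_of_nonneg_left hexp (by positivity)) hM
  have hDl : ∀ {l : ℕ}, 1 ≤ l → l ≤ k → ∀ (g : ScalarField P 0 N) (M D : ℝ), (∀ x, ‖g x‖ ≤ M) → 0 ≤ D →
      ∀ b : HiggsLattice.PBond P 0, (∀ z, g z ≠ 0 → D ≤ (HiggsLattice.Site.tdist b.src z : ℝ)) →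
        ‖covDeriv C A (propagatorK C Finset.univ A msq a l g) b‖
          ≤ c₀' * P.mesh l * Real.exp (-(δ K₀ * (D / (P.L : ℝ) ^ l))) * M := by
    intro l hl1 hlk g M D hg hD0 b hsupp
    have hmesh_l : P.mesh l ≤ 1 := (mesh_mono P hlk).trans hmesh
    have h := hD K₀ hK₂ P rfl rfl hK₀M h3M hl1 (hlk.trans hkK) hmesh_l A (hpos₂ K₀).1 le_rfl
      (reg223_of_small C A hlk hmesh_l (hpos₂ K₀).1 hδA hreg hte₂ le_rfl) g M D hg hD0 b hsupp
    refine h.trans ?_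
    have hM : 0 ≤ M := (norm_nonneg _).trans (hg b.src)
    have hml : 0 < P.mesh l := P.mesh_pos l
    have hexp := exp_rate_mono hδ₂ (show (0 : ℝ) ≤ D / (P.L : ℝ) ^ l by positivity)
    exact mul_le_mul_of_nonneg_right (mul_le_mul_of_nonneg_left hexp (by positivity)) hM
  have hCl : ∀ {l : ℕ}, 1 ≤ l → l < k → ∀ s t : HiggsLattice.Site P l × Ix N,
      |mat (fluctCovA C Finset.univ A msq a l) s t|
        ≤ c₁ K₀ * P.mesh l ^ 2 * Real.exp (-(δ K₀ * (HiggsLattice.Site.tdist s.1 t.1 : ℝ))) := by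
    intro l hl1 hlk s t
    have hmesh_l : P.mesh l ≤ 1 := (mesh_mono P hlk.le).trans hmesh
    have htl : (P.L : ℝ) ^ l * δA * |C.e| ≤ tA K₀ := by
      have hpow : (P.L : ℝ) ^ l ≤ (P.L : ℝ) ^ k := pow_le_pow_right₀ hLge1 hlk.le
      have h0 : 0 ≤ δA * |C.e| := mul_nonneg hδA (abs_nonneg _)
      nlinarith
    have h := (hCov K₀ hK₃ P S rfl rfl hK₀M h3M hl1 (lt_of_lt_of_le hlk hkK) hmesh_l A hδA hreg htl Finset.univ
      (p := s) (q := t) (Finset.mem_univ _) (Finset.mem_univ _)).1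
    rw [HiggsCondCov232.condCov232_univ] at h
    refine h.trans ?_
    have hexp := exp_rate_mono hδ₃ (Nat.cast_nonneg _ : (0 : ℝ) ≤ (HiggsLattice.Site.tdist s.1 t.1 : ℝ))
    calc P.mesh l ^ 2 * c₁ K₀ * Real.exp (-(ρ₃ K₀ * (HiggsLattice.Site.tdist s.1 t.1 : ℝ)))
        ≤ P.mesh l ^ 2 * c₁ K₀ * Real.exp (-(δ K₀ * (HiggsLattice.Site.tdist s.1 t.1 : ℝ))) :=
          mul_le_mul_of_nonneg_left hexp (by positivity)
      _ = _ := by ring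
  -- rate bookkeeping: `δ/(2L) ≤ δ/2` and the `j = 0` exponent
  have hrate : δ K₀ / (2 * P.L) ≤ δ K₀ / 2 := by
    rw [div_le_div_iff₀ (by positivity) (by norm_num : (0 : ℝ) < 2)]
    nlinarith
  have hexp0 : ∀ x x' : HiggsLattice.Site P 0,
      Real.exp (-(δ K₀ * ((HiggsLattice.Site.tdist x x' : ℝ) / (P.L : ℝ) ^ 1)))
        ≤ Real.exp (-(δ K₀ / (2 * P.L) * ((HiggsLattice.Site.tdist x x' : ℝ) / (P.L : ℝ) ^ 0))) := by
    intro x x'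
    apply exp_le_exp_of_le
    rw [pow_one, pow_zero, div_one]
    have h0 : 0 ≤ δ K₀ * ((HiggsLattice.Site.tdist x x' : ℝ) / P.L) := by positivity
    calc δ K₀ / (2 * P.L) * (HiggsLattice.Site.tdist x x' : ℝ) = (1 / 2) * (δ K₀ * ((HiggsLattice.Site.tdist x x' : ℝ) / P.L)) := by
          ring
      _ ≤ δ K₀ * ((HiggsLattice.Site.tdist x x' : ℝ) / P.L) := by linarith
  have hexpj : ∀ (j : ℕ) (x x' : HiggsLattice.Site P 0),
      Real.exp (-(δ K₀ / 2 * ((HiggsLattice.Site.tdist x x' : ℝ) / (P.L : ℝ) ^ j)))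
        ≤ Real.exp (-(δ K₀ / (2 * P.L) * ((HiggsLattice.Site.tdist x x' : ℝ) / (P.L : ℝ) ^ j))) :=
    fun j x x' => exp_rate_mono hrate (by positivity)
  refine ineq210_of_bounds (fun j x x' => ?_) (fun j μ x x' => ?_)
  · -- the value member
    have hmj : 0 < P.mesh j := P.mesh_pos j
    rcases Nat.eq_zero_or_pos j with rfl | hj1
    · refine (absG_piece_zero_le C A msq (k := k) (hGl le_rfl hk1) x x').trans ?_
      exact mul_le_mul (mul_le_mul_of_nonneg_right (le_cst210_zero hc₀.le hc₀'.le hc₁) (by positivity)) (hexp0 x x')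
        (Real.exp_pos _).le (by positivity)
    · by_cases hjk : j < k
      · refine (absG_piece_pos_le C A msq ha hL1 hj1 hjk (hjk.le.trans hkK) hc₀.le hc₁ hδK (hGl hj1 hjk.le)
          (hCl hj1 hjk) x x').trans ?_
        exact mul_le_mul (mul_le_mul_of_nonneg_right (le_cst210_pos hc₀.le hc₀'.le hc₁) (by positivity)) (hexpj j x x')
          (Real.exp_pos _).le (by positivity)
      · rw [absG_piece_ge_eq_zero C A msq hj1 (not_lt.mp hjk)]
        positivity
  · -- the covariant-derivative member
    have hmj : 0 < P.mesh j := P.mesh_pos j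
    rcases Nat.eq_zero_or_pos j with rfl | hj1
    · refine (absDG_piece_zero_le C A msq (k := k) (hDl le_rfl hk1) μ x x').trans ?_
      exact mul_le_mul (mul_le_mul_of_nonneg_right (le_cst210_zero' hc₀.le hc₀'.le hc₁) (by positivity)) (hexp0 x x')
        (Real.exp_pos _).le (by positivity)
    · by_cases hjk : j < k
      · refine (absDG_piece_pos_le C A msq ha hL1 hj1 hjk (hjk.le.trans hkK) hc₀.le hc₀'.le hc₁ hδK (hGl hj1 hjk.le)
          (hDl hj1 hjk.le) (hCl hj1 hjk) μ x x').trans ?_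
        exact mul_le_mul (mul_le_mul_of_nonneg_right (le_cst210_pos' hc₀.le hc₀'.le hc₁) (by positivity)) (hexpj j x x')
          (Real.exp_pos _).le (by positivity)
      · rw [absDG_piece_ge_eq_zero C A msq hj1 (not_lt.mp hjk)]
        positivity

/-- **Non-vacuity of the hypotheses of `ineq210_regularTorus`**: for every threshold there are admissible cube sizes `K₀ ≥ K₀,min`
and volumes of the family tiled by `K₀`-cubes with a scale `k = 1 ≤ K`, `L^1ε ≤ 1` (take `K₀ = L^n`, `M = L^{n+1}`, `L′_μ = 1`,
`ε = 1/L`, `K = 1`); the background `A = 0` is `0`-regular and `L^k·0·|e| = 0 ≤ t`. [cite: Balaban1982Higgs1, (1.2) p.604] -/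
theorem regularTorus_hypotheses_nonvacuous (d L : ℕ) (hd : 1 ≤ d) (hL : Odd L ∧ 1 < L) (K₀min : ℕ) :
    ∃ K₀ : ℕ, K₀min ≤ K₀ ∧ ∃ (P : HiggsLattice.Params) (_S : Shape P),
      P.d = d ∧ P.L = L ∧ K₀ ∣ P.M ∧ 3 * K₀ ≤ 2 * P.M ∧ 1 ≤ P.K ∧ P.mesh 1 ≤ 1 := by
  have hL0 : 0 < L := by omega
  refine ⟨L ^ K₀min, (Nat.lt_pow_self hL.2).le, ?_⟩
  refine ⟨⟨d, ((L : ℝ))⁻¹, 1, L, L ^ (K₀min + 1), fun _ => 1, hd, by positivity, hL0, by positivity, fun _ => one_pos⟩,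
    ⟨K₀min + 1, hL, fun _ => mul_one _⟩, rfl, rfl, pow_dvd_pow L (Nat.le_succ _), ?_, le_rfl, ?_⟩
  · calc 3 * L ^ K₀min ≤ 2 * L * L ^ K₀min := Nat.mul_le_mul_right _ (by omega)
      _ = 2 * L ^ (K₀min + 1) := by ring
  · show (L : ℝ) ^ 1 * ((L : ℝ))⁻¹ ≤ 1
    rw [pow_one, mul_inv_cancel₀ (by exact_mod_cast hL0.ne')]

end Main


end Literature.MathematicalPhysics.QuantumFieldTheory.Balaban1983to89.B3Ineq210RegularTorus

end
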